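import Literature.MathematicalPhysics.QuantumFieldTheory.Borinsky2020.ConvergenceTheorem
import Literature.MathematicalPhysics.QuantumFieldTheory.Borinsky2020.TropicalSamplingEstimator
import HarnessLib

/-!
# Borinsky's geometric sector decomposition on a simplicial fan and the general tropical sampling algorithm (AIHPD 2023 = arXiv:2008.12310, §4: **Lemma 16** (on a cone of the common refinement the tropical part is one monomial `x^{−w}`, `⟨𝟙,w⟩ = 0`, `⟨y,w⟩ > 0`), **Theorem 19** (Geometric sector decomposition: `I[f] = Σ_{𝒞∈𝓜} I_𝒞[f]`, eq. (evalCintegral)), **Proposition 20** (Algorithm 1: `I = 𝔼[I^{(N)}]`, `var[I^{(N)}] = C/N`); §5: **eq. (def_Itr_secdec)** `I^tr = Σ_𝒞 I^tr_𝒞`, `I^tr_𝒞 > 0`, and **Proposition 21**: Algorithm 3 generates samples distributed as `μ^tr`) — PROVED, for a GENERAL simplicial fan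

independent recomputation; certified where stated, statistical where stated; no new-physics claim.

CITATION HEADER (venture `QEDPrecision`, cell `pub-qed`, track TROPICAL, LIT seat `pub-qed-trop-lit` gen 28; VALUE-FREE: statements about
ABSTRACT polynomials, polytopes, cones and one parametric integral form — no Feynman graph, no Monte-Carlo value, nothing per word or per
Set V family). COMPLETES the general-fan half of §4–§5 that the companions left open: `ConeIntegral.lean` (Lemma 17 in the affine chart, "NOT
typed: … Theorem 19's summation over a fan"), `ConvergenceTheorem.lean` (Theorem 3, Lemma 15, `I^tr`, `μ^tr`; "NOT typed: Theorem 19 / Lemma 16 /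
Lemma 17's fan statements for a GENERAL fan (the sector SUM) … that Algorithms 3 / 4 SAMPLE from μ^tr"), `GeneralizedPermutahedronSampling.lean`
(Theorem 27 / Proposition 29 / Proposition 31 = the braid-fan case; "NOT typed: Theorem 19 / Algorithm 3 / Proposition 20 for a GENERAL simplicial
fan"), `TropicalSamplingEstimator.lean` (Theorem 5 for Algorithm 2; "the mechanism of Proposition 20"). Serves: the track's source sheet
`tropical/lit/SOURCES.md` §1.4–§1.5 / A28 and ORACLE-MAP r2 §0b (i) / §6 (Theorem 19 = AIHPD Thm 4.5, Algorithm 1 / Prop. 4.6, Algorithm 3 /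
Prop. 5.1, eq. (5.3) — now tree theorems); E2 / E3 (a sampler on an explicitly triangulated fan — Remark 35's route — meets
`algorithm3_law_eq_tropicalMeasure`; a per-sector quadrature meets `integral_algorithm1_eq_integral_tropical_mul` / `variance_algorithm1`); T1 / T3
(what "all sector exponents positive" buys for ONE product quotient: `cone_pairing_pos_of_gap`, the sector law of Theorem 19).

Source [Borinsky2020]: M. Borinsky, "Tropical Monte Carlo quadrature for Feynman integrals", Ann. Inst. Henri Poincaré D 10 (2023) 635–685,
doi:10.4171/aihpd/158 = arXiv:2008.12310v2 (LaTeX e-print held by the cell, HOME `data/lit/sources/.cache/2008.12310/tropical.tex`; theorem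
numbers = the e-print's single shared counter as in the companion files; journal concordance (source sheet §1.9 / A4.1): Lemma 16 = AIHPD Lemma
4.2 p. 653, Lemma 17 = Lemma 4.3 p. 654, Remark 18 = Remark 4.4 p. 654, Theorem 19 = Thm 4.5 p. 655, eq. (evalCintegral) = (4.2), Proposition 20 =
Prop. 4.6 p. 657, eq. (def_Itr_secdec) = (5.3), Proposition 21 = Prop. 5.1 p. 660, eq. (mu_probability) = (5.2); Algorithms 1, 3 keep their
numbers, pp. 657, 660). VERBATIM. §4 (l.696–700): "Given a fan ℱ, another fan ℱ' refines ℱ if every cone in ℱ is a union of cones in ℱ'. …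
Let ℱ_{𝒜ℬ} be the common refinement of the normal fans of the polytopes 𝒜 and ℬ … We will therefore consider the reduced refined normal fan
ℱ_{𝒜ℬ}/𝟙ℝ, which is pointed. The following lemma identifies the exponentiated cones of 𝒞 ∈ ℱ_{𝒜ℬ}/𝟙ℝ as the domains where the function
Π_i a_i^tr(x)^{Re ν_i}/Π_j b_j^tr(x)^{Re ρ_j} behaves like a monomial." **Lemma 16** (l.702–710): "Let 𝒜 and ℬ be the polytopes defined in
Theorem 3. If 𝒜 and ℬ fulfill the requirements R1 and R2 of Theorem 3 and 𝒞 is a cone in the reduced common refinement ℱ_{𝒜ℬ}/𝟙ℝ, then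
Π_i a_i^tr(x)^{Re ν_i}/Π_j b_j^tr(x)^{Re ρ_j} = x^{−w} for all x ∈ Exp(𝒞), where w = w_ℬ − w_𝒜 and w_𝒜 ∈ 𝒜, w_ℬ ∈ ℬ such that ⟨y, w_𝒜⟩ =
max_{v∈𝒜}⟨y,v⟩ and ⟨y, w_ℬ⟩ = max_{v∈ℬ}⟨y,v⟩ for all y ∈ 𝒞. Moreover, ⟨𝟙, w⟩ = 0 and ⟨y, w⟩ > 0 for all y ∈ 𝒞∖{0}." Its proof (l.712–721):
"As 𝒞 is a refinement of the normal fans of 𝒜 and ℬ, there must be normal cones 𝒞^𝒜_{F_𝒜} and 𝒞^ℬ_{F_ℬ} associated to respective faces F_𝒜 ⊂ 𝒜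
and F_ℬ ⊂ ℬ such that 𝒞 ⊂ 𝒞^𝒜_{F_𝒜} ∩ 𝒞^ℬ_{F_ℬ}. Hence, max_{v∈ℬ}⟨y,v⟩ − max_{v∈𝒜}⟨y,v⟩ = ⟨y, (w_ℬ − w_𝒜)⟩ for all y ∈ 𝒞, where we can choose
arbitrary w_𝒜 ∈ F_𝒜 and w_ℬ ∈ F_ℬ by definition of the normal cone in eq. (normal_cone). Since 𝒜 and ℬ are required to lie in the same
hyperplane orthogonal to the 𝟙-vector, we also have ⟨𝟙, (w_ℬ − w_𝒜)⟩ = ⟨𝟙, w⟩ = 0. Due to Lemma 15, … ≥ ε‖y‖_{ℝⁿ/𝟙ℝ} > 0 for all y ∈ 𝒞∖{0}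
and the statement follows from eq. (atrbtr_exp)." (l.736–740): "A cone 𝒞 is simplicial if it is generated as, 𝒞 = {Σ_{k=1}^d λ_k u^{(k)} :
λ_k ≥ 0} where u^{(1)}, … u^{(d)} are linear independent. For a given cone 𝒞, we can always find a set of simplicial cones … Such a set of
simplicial cones is called a triangulation of 𝒞. Let ℱ^Δ_{𝒜ℬ}/𝟙ℝ be a simplicial refinement of ℱ_{𝒜ℬ}/𝟙ℝ". **Remark 18** (l.754–760): "By
slightly abusing the notation, we identified the vectors u^{(1)}, …, u^{(n−1)} with appropriate representatives in ℝⁿ in the statement of this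
lemma. The value of the integral does not depend on the specific choice of representatives, because ⟨𝟙, w⟩ = 0 and f is homogeneous of degree
zero." **Theorem 19** [Geometric sector decomposition] (l.776–802): "Let 𝒜 and ℬ be the polytopes defined in Theorem 3. If 𝒜 and ℬ fulfill
the requirements R1 and R2 of Theorem 3 and 𝓜^Δ_{𝒜ℬ} ⊂ ℱ^Δ_{𝒜ℬ}/𝟙ℝ is the set of maximal cones, i.e. the cones of maximal dimension, in a
simplicial refinement of the reduced common normal fan of 𝒜 and ℬ, then we can write the integral I[f] = ∫_{ℙ^{n−1}_{>0}} (Π_i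
a_i^tr(x)^{Re ν_i}/Π_j b_j^tr(x)^{Re ρ_j}) f(x) Ω. as a sum I[f] = Σ_{𝒞∈𝓜^Δ_{𝒜ℬ}} I_𝒞[f] with (evalCintegral) I_𝒞[f] = |det(u^{(𝒞,1)}, …,
u^{(𝒞,n−1)}, 𝟙)| / Π_{k=1}^{n−1} ⟨u^{(𝒞,k)}, w^{(𝒞)}⟩ ∫_{[0,1]^{n−1}} f(x^{(𝒞)}(ξ)) Π_{k=1}^{n−1} dξ_k, where • f : ℙ^{n−1}_{>0} → ℂ is a
measurable homogeneous function of degree 0, • w^{(𝒞)} = w^{(𝒞)}_ℬ − w^{(𝒞)}_𝒜 with some w^{(𝒞)}_𝒜 ∈ 𝒜 and w^{(𝒞)}_ℬ ∈ ℬ such that ⟨y,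
w^{(𝒞)}_𝒜⟩ = max_{v∈𝒜}⟨y,v⟩ and ⟨y, w^{(𝒞)}_ℬ⟩ = max_{v∈ℬ}⟨y,v⟩ for all y ∈ 𝒞, • the vectors u^{(𝒞,1)}, …, u^{(𝒞,n−1)} ∈ ℝⁿ/𝟙ℝ span the
simplicial cone 𝒞 such that 𝒞 = {Σ_k λ_k u^{(𝒞,k)} : λ_k ≥ 0} ⊂ ℝⁿ/𝟙ℝ, • x^{(𝒞)}(ξ) ∈ Exp(𝒞) is given component-wise by x_k^{(𝒞)} = Π_{i=1}^{n−1}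
ξ_i^{−u_k^{(𝒞,i)}/(⟨u^{(𝒞,i)}, w^{(𝒞)}⟩)} and • the prefactor |det(u^{(𝒞,1)}, …, u^{(𝒞,n−1)}, 𝟙)| / Π_{k=1}^{n−1} ⟨u^{(𝒞,k)}, w^{(𝒞)}⟩ is finite and
positive for each 𝒞 ∈ 𝓜^Δ_{𝒜ℬ}." Its proof (l.804–822): "The fan ℱ^Δ_{𝒜ℬ}/𝟙ℝ is complete, i.e. it corresponds to a partition of ℝⁿ/𝟙ℝ =
⊎_𝒞 𝒞. Because Exp: ℝⁿ/𝟙ℝ → ℙ^{n−1}_{>0} is smooth and bijective this partition gives also a partition of ℙ^{n−1}_{>0} = ⊎ Exp(𝒞). Since we would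
like to integrate over ℙ^{n−1}_{>0} … it is enough to only consider the cones of maximal dimension 𝓜^Δ_{𝒜ℬ} … as other cones … only describe
measure zero subsets of ℙ^{n−1}_{>0}. Hence, I = Σ_{𝒞∈𝓜^Δ_{𝒜ℬ}} I_𝒞, I_𝒞 = ∫_{Exp(𝒞)} (Π_i a_i^tr^{Re ν_i}/Π_j b_j^tr^{Re ρ_j}) f(x) Ω. Because
each cone 𝒞 ∈ 𝓜^Δ_{𝒜ℬ} refines a cone in ℱ_{𝒜ℬ}/𝟙ℝ and because of Lemma 16, I_𝒞 = ∫_{Exp(𝒞)} x^{−w^{(𝒞)}} f(x) Ω … Eq. (evalCintegral) follows from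
Lemma 17 … As ⟨y, w^{(𝒞)}⟩ > 0 for all y ∈ 𝒞∖{0}, we also have ⟨u^{(𝒞,k)}, w^{(𝒞)}⟩ > 0 for all k ∈ {1,…,n−1}. The positivity of the determinant
is obvious because of the linear independence of the vectors u^{(𝒞,k)}." (l.835–837): "If we have triangulated the reduced normal fan … and
stored the vectors u^{(𝒞,1)}, …, u^{(𝒞,n−1)} and w^{(𝒞)} for each maximal cone … in a table, then we can estimate the integral using Algorithm 1."
**Algorithm 1** [Basic Monte Carlo quadrature of Euler-Mellin integrals] (l.839–857): "for all maximal cones 𝒞 ∈ 𝓜^Δ_{𝒜ℬ}: for ℓ ∈ 1,…,N: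
Draw a random vector ξ ∈ [0,1]^{n−1} from the distribution 1 = ∫ Π dξ_i. Set x_k^{(ℓ)} = Π_i ξ_i^{−u_k^{(𝒞,i)}/⟨u^{(𝒞,i)},w^{(𝒞)}⟩} for all k. Set
I_𝒞^{(N)}[R_{a/b}] = (1/N) |det(u^{(𝒞,1)},…,u^{(𝒞,n−1)},𝟙)|/Π_k⟨u^{(𝒞,k)},w^{(𝒞)}⟩ Σ_{ℓ=1}^N R_{a/b}(x^{(ℓ)}). Return I^{(N)} = Σ_𝒞 I_𝒞^{(N)}[R_{a/b}]."
**Proposition 20** (l.859–867): "If the conditions of Theorem 3 are fulfilled, then the random value I^{(N)} returned by Algorithm 1 has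
expectation value equal to the integral in eq. (integral), I = 𝔼[I^{(N)}] and var[I^{(N)}] = C/N with some constant C ≥ 0. *Proof.* Algorithm 1
is an application of Theorem 5 on the integral I_𝒞[f] for each cone … with f(x) = R_{a/b}(x) … As |R_{a/b}(x)| is bounded on ℙ^{n−1}_{>0} … the
integrand is bounded and therefore also square integrable. Hence, there is a constant C_𝒞 ≥ 0 for each cone integral such that var[I_𝒞^{(N)}] =
C_𝒞/N and var[I^{(N)}] = Σ_𝒞 var[I_𝒞^{(N)}] = C/N." §5 **eq. (def_Itr_secdec)** (l.918–920): "By Theorem 19 the tropically approximated integral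
in eq. (integral_trop) can be written as a sum, I^tr = Σ_{𝒞∈𝓜^Δ_{𝒜ℬ}} I^tr_𝒞 with I^tr_𝒞 = |det(u^{(𝒞,1)}, …, u^{(𝒞,n−1)}, 𝟙)| / Π_{k=1}^{n−1}
⟨u^{(𝒞,k)}, w^{(𝒞)}⟩, where I^tr_𝒞 > 0 for all maximal cones … Hence, we can interpret I^tr_𝒞/I^tr as a probability assigned to each cone … and draw
a random cone accordingly." **Algorithm 3** [Algorithm to generate a sample with distribution μ^tr] (l.925–934): "Draw a random cone 𝒞 ∈
𝓜^Δ_{𝒜ℬ} with probability I^tr_𝒞/I^tr. Draw a random vector ξ ∈ [0,1]^{n−1} from the uniform distribution. Set x_k = Π_{i=1}^{n−1}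
ξ_i^{−u_k^{(𝒞,i)}/(⟨u^{(𝒞,i)}, w^{(𝒞)}⟩)} for all k ∈ {1,…,n}. Return x = [x_1:…:x_n] ∈ Exp 𝒞 ⊂ ℙ^{n−1}_{>0} and 𝒞." **Proposition 21** (l.936–946):
"Algorithm 3 generates a sample x ∈ ℙ^{n−1}_{>0}, distributed as μ^tr in eq. (mu_probability). *Proof.* For any test function f : ℙ^{n−1}_{>0}
→ ℂ and a random sample x … generated by Algorithm 3, we have 𝔼[f(x)] = Σ_𝒞 I^tr_𝒞/I^tr ∫_{[0,1]^{n−1}} f(x^{(𝒞)}(ξ)) Π dξ_k. Using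
eq. (def_Itr_secdec) and Theorem 19 gives 𝔼[f(x)] = (1/I^tr) ∫ (Π_i a_i^tr^{Re ν_i}/Π_j b_j^tr^{Re ρ_j}) f(x) Ω = ∫ f(x) μ^tr." (l.948): "To run
both Algorithms 2 and 3 together we need N evaluations of the function R_{a/b}(x) … the runtime is now independent of the number of sectors."
§7 Remark 35 (l.1229–1231, the general-kinematics route): "For general non-Euclidean kinematics, the Newton polytope of Φ_G is not a
generalized permutahedron. … We emphasize that the general tropical sampling algorithm introduced in Section 5 still applies. The caveat is
that an explicit triangulation has to be computed in contrast to the generalized permutahedron case where no explicit triangulation is necessary."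

TYPING (as in `ConvergenceTheorem.lean` / `GeneralizedPermutahedronSampling.lean`: ambient dimension written `n + 1`, variables `x_0, …, x_n :
Fin (n+1)`; every integral statement in the CHART `x_n = 1` of eq. (integral_euler_mellin) in logarithmic coordinates `y ∈ ℝⁿ`, `x = e^{(y,0)}`
— the chart in which the companions type `I^tr` and `μ^tr`; REAL exponents `ν_i, ρ_j ≥ 0` = the printed `Re ν_i, Re ρ_j`; NO new definition —
D-0026 economy — the Newton polytopes / Minkowski sums are written out with the companion's local notation `NP⟦·⟧`, the cones with
`ConeIntegral.coneMap` / `orthant` / `unitCube` / `logMap`, Algorithm 1's return value with `TropicalSamplingEstimator.tropicalEstimate` per cone).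
THE FAN DATA of Theorem 19 is typed as the print USES it, not as an abstract fan object (Mathlib has none): a finite index type `𝓜` of maximal
cones; for each `𝒞 ∈ 𝓜` an invertible generator matrix `U_𝒞 : Matrix (Fin n) (Fin n) ℝ` whose column `k` is the generator `u^{(𝒞,k)}` IN CHART
COORDINATES — i.e. the representative with last coordinate `0`, which Remark 18 allows ("we identified the vectors … with appropriate representatives
… The value of the integral does not depend on the specific choice"), so that the printed `|det(u^{(𝒞,1)}, …, u^{(𝒞,n−1)}, 𝟙)|` IS `|det U_𝒞|`
(`det_border_one`: Laplace expansion along the last row), `⟨u^{(𝒞,k)}, w^{(𝒞)}⟩` is `⟨(u^{(𝒞,k)}, 0), w^{(𝒞)}⟩` and the printed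
`x^{(𝒞)}(ξ)_m = Π_k ξ_k^{−u_m^{(𝒞,k)}/⟨u^{(𝒞,k)}, w^{(𝒞)}⟩}` has `x_n = 1` (the chart); "complete fan … partition … other cones only describe measure zero
subsets" = the open cones `{U_𝒞 λ : λ > 0}` (`coneMap U_𝒞 '' orthant n`) cover `ℝⁿ` up to a Lebesgue-null set and are pairwise a.e.-disjoint;
"𝒞 refines a cone of the common refinement ℱ_{𝒜ℬ}" = the theorem's own second item: points `w_𝒜^{(𝒞)} ∈ 𝒜`, `w_ℬ^{(𝒞)} ∈ ℬ` maximising `⟨y,·⟩` for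
EVERY `y` of the CLOSED cone `{U_𝒞 λ : λ ≥ 0}` (eq. (normal_cone): `𝒞 ⊂ 𝒞^𝒜_{F_𝒜} ∩ 𝒞^ℬ_{F_ℬ}`). The printed test function "f : ℙ^{n−1}_{>0} → ℂ
measurable homogeneous of degree 0" is a bounded measurable `f : (Fin (n+1) → ℝ) → ℝ` evaluated at the chart point (in the chart neither the
homogeneity of `f` nor `⟨𝟙, w⟩ = 0` is needed — they are exactly what makes the projective statement representative-independent, Remark 18; both
are typed separately: `sum_sub_eq_zero_of_isHomogeneous`). HYPOTHESIS "R1 and R2": typed, as in every `…_of_gap` theorem of the companions, as the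
GAP of Lemma 15 `ε (y_k − y_{k'}) ≤ max_ℬ⟨y,·⟩ − max_𝒜⟨y,·⟩` (which R1 ∧ R2 give: `ConvergenceTheorem.ball_of_R1_R2` + `gap_of_ball`; the R1 ∧ R2
form of Theorem 19 is `integral_tropical_mul_eq_sum_cones_of_R1_R2`); R3 is not involved (the statements are about the tropical weight and a test
function; `R_{a/b}` enters Proposition 20 as ANY bounded measurable `R`, its boundedness under R3 being Corollary 9 =
`TropicalLowerBound.exists_abs_residual_le`). ALGORITHM 1 is typed as the sum over `𝒞 ∈ 𝓜` of the companion's i.i.d. mean `tropicalEstimate` with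
`I^tr` replaced by the cone prefactor, fed by draws `ξ^{(𝒞,ℓ)}` with law `vol|_{[0,1]^n}` (`HasLaw`), all independent (`iIndepFun` over `𝓜 × ℕ` —
the independence ACROSS cones that the printed "var[I^{(N)}] = Σ_𝒞 var[I_𝒞^{(N)}]" uses tacitly). ALGORITHM 3's output LAW is the finite mixture
over `𝒞 ∈ 𝓜` with weights `I^tr_𝒞/I^tr` of the images of the uniform law on the cube under `ξ ↦ x^{(𝒞)}(ξ)`, read in the chart through
`x ↦ (log(x_j/x_n))_{j<n}` for the measure identity (as in the companion's Proposition 31).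

PROOF ROUTE (the printed one; disclosed deviations: none of substance). Lemma 16: eq. (atrbtr_exp) (`ConvergenceTheorem.prod_trop_rpow_div_eq_exp`)
and "max_𝒜⟨y,·⟩ = ⟨y, w_𝒜⟩" for a maximiser (`sum_faceValue_eq_dotProduct_of_isMaxOn`, from the companion's two support-function lemmas);
`⟨𝟙,w⟩ = 0` from Remark 4 (`sum_eq_of_mem_minkowskiSum`); `⟨y,w⟩ > 0` from the gap. Theorem 19: (1) `∫_{ℝⁿ} = ∫_{⋃ 𝒞}` (null complement,
`integral_eq_setIntegral`); (2) "I = Σ_𝒞 I_𝒞" (`integral_iUnion_ae`, the cones being measurable as homeomorphic images of the open orthant); (3) on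
`𝒞` the weight is `e^{−⟨y, w^{(𝒞)}⟩}` (Lemma 16 at `y = U_𝒞 λ`, `λ > 0`); (4) Lemma 17 in the affine chart, in full, is the companion's
`ConeIntegral.integral_cone_mul_exp_neg_eq_unitCube` (barycentric coordinates, Jacobian `|det U_𝒞|`, the substitution `λ_k = −log ξ_k/⟨u^{(𝒞,k)},w^{(𝒞)}⟩`),
whose positivity input `⟨u^{(𝒞,k)}, w^{(𝒞)}⟩ > 0` is the printed sentence "As ⟨y, w^{(𝒞)}⟩ > 0 for all y ∈ 𝒞∖{0}, we also have ⟨u^{(𝒞,k)}, w^{(𝒞)}⟩ > 0"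
(`cone_pairing_pos_of_gap`: the generator `U_𝒞 e_k` lies in the closed cone and is not a multiple of `𝟙` since a column of an invertible matrix
is non-zero); (5) `e^{(U_𝒞 λ(ξ), 0)} = x^{(𝒞)}(ξ)` entrywise (`Real.rpow_def_of_pos`). Proposition 21 as printed ("Using eq. (def_Itr_secdec) and
Theorem 19") together with the companion's `I = I^tr ∫ R μ^tr` (`integral_mul_eq_integral_mul_integral_withDensity`), and the measure identity by
testing against `𝟙_S ∘ chart`. Proposition 20 as printed ("an application of Theorem 5 … for each cone"): expectation by the companion's
`integral_tropicalEstimate` per cone + Theorem 19; variance by writing `I^{(N)}` as ONE sum over `(𝒞, ℓ) ∈ 𝓜 × {0,…,N−1}` of pairwise independent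
square-integrable terms (Mathlib's `IndepFun.variance_sum`, `variance_const_mul`, `IdentDistrib.variance_eq`).

PROVED (0 named facts, 0 definitions, D-0026; Mathlib + the companion files only):
* **Lemma 16**: `sum_faceValue_eq_dotProduct_of_isMaxOn` (support function at a maximiser), **`prod_trop_rpow_div_eq_exp_neg_dotProduct_of_isMaxOn`**
  (the monomial `e^{−⟨y, w_ℬ − w_𝒜⟩}`), `sum_sub_eq_zero_of_isHomogeneous` (`⟨𝟙, w⟩ = 0`), `dotProduct_sub_pos_of_gap` (`⟨y, w⟩ > 0` off `ℝ𝟙`);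
* plumbing: `measurableSet_coneMap_image`, `snoc_zero_dotProduct`, `exists_apply_ne_zero_of_det_ne_zero`, **`det_border_one`** (Remark 18:
  `det(u^{(1)},…,u^{(n)},𝟙) = det U` for chart representatives), `measurable_conePoint`;
* **Theorem 19**: `cone_pairing_pos_of_gap` (`⟨u^{(𝒞,k)}, w^{(𝒞)}⟩ > 0`), **`integral_tropical_mul_eq_sum_cones_of_gap`** (the sector decomposition
  `I[f] = Σ_𝒞 |det U_𝒞| / Π_k⟨u^{(𝒞,k)},w^{(𝒞)}⟩ · ∫_{[0,1]^n} f(x^{(𝒞)}(ξ)) dξ` under the gap), **`integral_tropical_mul_eq_sum_cones_of_R1_R2`** (under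
  R1 ∧ R2 as printed, homogeneous denominators);
* **eq. (def_Itr_secdec)**: **`integral_tropical_eq_sum_cones_of_gap`** (`I^tr = Σ_𝒞 I^tr_𝒞`), `cone_tropical_pos_of_gap` (`I^tr_𝒞 > 0`);
* **Proposition 21**: **`algorithm3_expectation_eq_integral_tropicalMeasure`** (`𝔼_{Alg.3}[f(x)] = Σ_𝒞 (I^tr_𝒞/I^tr) ∫_{[0,1]^n} f(x^{(𝒞)}(ξ)) dξ = ∫ f dμ^tr`
  for bounded measurable `f`) and **`algorithm3_law_eq_tropicalMeasure`** (the law of Algorithm 3's output, read in the chart, IS `μ^tr` — an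
  identity of measures on `ℝⁿ`, `μ^tr` EXACTLY the withDensity measure of `ConvergenceTheorem.isProbabilityMeasure_tropicalMeasure_of_gap`);
* **Proposition 20 / Algorithm 1**: **`integral_algorithm1_eq_integral_tropical_mul`** (`𝔼[I^{(N)}] = I[R]` for bounded measurable `R`, `N ≥ 1`),
  **`variance_algorithm1`** (`var[I^{(N)}] = (Σ_𝒞 pref_𝒞² var_{U[0,1]^n}[R∘x^{(𝒞)}])/N` — the constant `C` explicit), `variance_algorithm1_le`
  (`≤ (Σ_𝒞 pref_𝒞²) B²/N` for `|R| ≤ B`).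
NOT typed: the EXISTENCE and construction of a simplicial refinement of `ℱ_{𝒜ℬ}/𝟙ℝ` (the triangulation is INPUT data here, exactly as in the
print's "If we have triangulated the reduced normal fan … stored … in a table"; no fan / normal-fan objects are introduced); Theorem 19 for
arbitrary representatives `u^{(𝒞,k)} ∈ ℝⁿ` of the generators (Remark 18's invariance under `u ↦ u + μ𝟙`, `u ↦ λu` — only the normalised
representatives and the determinant identity are typed); complex exponents and ℂ-valued test functions; unbounded (merely μ^tr-integrable) test
functions; chart-independence of `I[f]` as a projective integral (one chart, as in the companions); the COST statements (l.875–880, l.948–958: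
"N|𝓜| evaluations", "the runtime is now independent of the number of sectors", the alias method) and §7's graph data; nothing on subtracted /
signed integrands or sums of diagrams (§8 items 4, 7). (Filed by the pub-qed TROPICAL literature seat `pub-qed-trop-lit` gen 28;
`tropical/lit/SOURCES.md` A28.)
-/

noncomputable section

namespace Literature.MathematicalPhysics.QuantumFieldTheory.Borinsky2020

/-- The exponent vectors `ℓ ∈ supp(p) ⊂ ℤⁿ` of `p` "interpreted as vectors in ℝⁿ" (tropical.tex l.297–299) — the same local notation as in
`ConvergenceTheorem.lean` (no new definition is introduced). -/
local notation3 (prettyPrint := false) "pts⟦" p "⟧" =>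
  ((fun d : (_ →₀ ℕ) => fun k => ((d k : ℕ) : ℝ)) '' {d | d ∈ MvPolynomial.support p})

/-- The Newton polytope `NP_p = conv(supp p)` — the same local notation as in `ConvergenceTheorem.lean` (no new definition is introduced). -/
local notation3 (prettyPrint := false) "NP⟦" p "⟧" => convexHull ℝ pts⟦p⟧

section Lemma16

open Real Finset Matrix MvPolynomial

open scoped Pointwise

variable {m : ℕ} {ι κ : Type*} [Fintype ι] [Fintype κ]
  (a : ι → MvPolynomial (Fin m) ℝ) (b : κ → MvPolynomial (Fin m) ℝ) (ν : ι → ℝ) (ρ : κ → ℝ)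

/-- If `w ∈ 𝒜 = Σ_i ν_i NP_{a_i}` maximises `⟨y, ·⟩` over `𝒜`, the support function of `𝒜` at `y` is `⟨y, w⟩`:
`Σ_i ν_i max_{v∈NP_{a_i}}⟨y,v⟩ = max_{v∈𝒜}⟨y,v⟩ = ⟨y, w⟩` ("w_𝒜 ∈ 𝒜 … such that ⟨y, w_𝒜⟩ = max_{v∈𝒜}⟨y,v⟩").
[cite: Borinsky2020, Lemma 16 (tropical.tex l.702–710); eq. (atrbtr_exp) (l.663–666); eq. (normal_cone)] -/
theorem sum_faceValue_eq_dotProduct_of_isMaxOn (ha : ∀ i, a i ≠ 0) (hν : ∀ i, 0 ≤ ν i) {y w : Fin m → ℝ}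
    (hw : w ∈ ∑ i, ν i • NP⟦a i⟧) (hmax : ∀ v ∈ ∑ i, ν i • NP⟦a i⟧, y ⬝ᵥ v ≤ y ⬝ᵥ w) :
    ∑ i, ν i * faceValue (a i) y = y ⬝ᵥ w := by
  obtain ⟨v, hv, hyv⟩ := exists_mem_minkowskiSum_dotProduct_eq a ha ν y
  refine le_antisymm ?_ (dotProduct_le_of_mem_minkowskiSum a hν y hw)
  rw [← hyv]
  exact hmax v hv

/-- **Lemma 16 (the tropical part is ONE monomial on a cone of the common refinement).** If `w_𝒜 ∈ 𝒜` and `w_ℬ ∈ ℬ` maximise `⟨y, ·⟩`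
over `𝒜` and `ℬ` respectively — i.e. `y` lies in the normal cones `𝒞_{F_𝒜}^𝒜 ∩ 𝒞_{F_ℬ}^ℬ` of faces containing them, eq. (normal_cone) —,
then in logarithmic coordinates `x = e^y`: "Π_i a_i^tr(x)^{Re ν_i}/Π_j b_j^tr(x)^{Re ρ_j} = x^{−w} … where w = w_ℬ − w_𝒜", i.e.
`= e^{−⟨y, w_ℬ − w_𝒜⟩}`. Pointwise form (the printed statement is this for all `y` of a cone `𝒞`).
[cite: Borinsky2020, Lemma 16 and its proof (tropical.tex l.702–722) (= AIHPD 10 (2023) Lemma 4.2 p. 653); eq. (atrbtr_exp) (l.663–666)] -/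
theorem prod_trop_rpow_div_eq_exp_neg_dotProduct_of_isMaxOn (ha : ∀ i, a i ≠ 0) (hb : ∀ j, b j ≠ 0) (hν : ∀ i, 0 ≤ ν i)
    (hρ : ∀ j, 0 ≤ ρ j) {y wA wB : Fin m → ℝ} (hwA : wA ∈ ∑ i, ν i • NP⟦a i⟧) (hwB : wB ∈ ∑ j, ρ j • NP⟦b j⟧)
    (hmaxA : ∀ v ∈ ∑ i, ν i • NP⟦a i⟧, y ⬝ᵥ v ≤ y ⬝ᵥ wA) (hmaxB : ∀ v ∈ ∑ j, ρ j • NP⟦b j⟧, y ⬝ᵥ v ≤ y ⬝ᵥ wB) :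
    (∏ i, trop (a i) (fun k => exp (y k)) ^ ν i) / ∏ j, trop (b j) (fun k => exp (y k)) ^ ρ j =
      exp (-(y ⬝ᵥ (wB - wA))) := by
  rw [prod_trop_rpow_div_eq_exp a b ν ρ ha hb y, sum_faceValue_eq_dotProduct_of_isMaxOn a ν ha hν hwA hmaxA,
    sum_faceValue_eq_dotProduct_of_isMaxOn b ρ hb hρ hwB hmaxB, dotProduct_sub]
  congr 1
  ring

/-- **Lemma 16, "Moreover, ⟨𝟙, w⟩ = 0"**: `𝒜` and `ℬ` lie in the same hyperplane orthogonal to `𝟙` (homogeneity of the `a_i`, `b_j`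
and eq. (homogeneous) `Σ_i ν_i deg a_i = Σ_j ρ_j deg b_j`, Remark 4), so `⟨𝟙, w_ℬ − w_𝒜⟩ = 0`.
[cite: Borinsky2020, Lemma 16 (tropical.tex l.709–710, proof l.719); Remark 4 (l.333–337); eq. (homogeneous) (l.229–233)] -/
theorem sum_sub_eq_zero_of_isHomogeneous {da : ι → ℕ} {db : κ → ℕ} (haH : ∀ i, (a i).IsHomogeneous (da i))
    (hbH : ∀ j, (b j).IsHomogeneous (db j)) (hdeg : ∑ i, ν i * da i = ∑ j, ρ j * db j)
    {wA wB : Fin m → ℝ} (hwA : wA ∈ ∑ i, ν i • NP⟦a i⟧) (hwB : wB ∈ ∑ j, ρ j • NP⟦b j⟧) :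
    ∑ k, (wB - wA) k = 0 := by
  simp only [Pi.sub_apply, Finset.sum_sub_distrib]
  rw [sum_eq_of_mem_minkowskiSum a ν haH hwA, sum_eq_of_mem_minkowskiSum b ρ hbH hwB, hdeg, sub_self]

/-- **Lemma 16, "and ⟨y, w⟩ > 0 for all y ∈ 𝒞 ∖ {0}"** — from the gap of Lemma 15 (`ε (y_k − y_{k'}) ≤ max_ℬ⟨y,·⟩ − max_𝒜⟨y,·⟩`):
at a point `y` where `w_𝒜`, `w_ℬ` are the maximisers, `⟨y, w_ℬ − w_𝒜⟩ = max_ℬ − max_𝒜 ≥ ε (y_k − y_{k'})`, which is positive as soon as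
`y` is not a multiple of `𝟙` (`y ≠ 0` in `ℝⁿ/𝟙ℝ`).
[cite: Borinsky2020, Lemma 16 (tropical.tex l.709–710, proof l.720–721); Lemma 15 (l.669–676)] -/
theorem dotProduct_sub_pos_of_gap (ha : ∀ i, a i ≠ 0) (hb : ∀ j, b j ≠ 0) (hν : ∀ i, 0 ≤ ν i) (hρ : ∀ j, 0 ≤ ρ j)
    {ε : ℝ} (hε : 0 < ε)
    (hgap : ∀ y : Fin m → ℝ, ∀ k k', ε * (y k - y k') ≤ (∑ j, ρ j * faceValue (b j) y) - ∑ i, ν i * faceValue (a i) y)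
    {y wA wB : Fin m → ℝ} (hwA : wA ∈ ∑ i, ν i • NP⟦a i⟧) (hwB : wB ∈ ∑ j, ρ j • NP⟦b j⟧)
    (hmaxA : ∀ v ∈ ∑ i, ν i • NP⟦a i⟧, y ⬝ᵥ v ≤ y ⬝ᵥ wA) (hmaxB : ∀ v ∈ ∑ j, ρ j • NP⟦b j⟧, y ⬝ᵥ v ≤ y ⬝ᵥ wB)
    {k k' : Fin m} (hkk' : y k' < y k) :
    0 < y ⬝ᵥ (wB - wA) := by
  have h := hgap y k k'
  rw [sum_faceValue_eq_dotProduct_of_isMaxOn a ν ha hν hwA hmaxA,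
    sum_faceValue_eq_dotProduct_of_isMaxOn b ρ hb hρ hwB hmaxB, ← dotProduct_sub] at h
  exact lt_of_lt_of_le (mul_pos hε (sub_pos.mpr hkk')) h

end Lemma16

section Cones

open MeasureTheory Set Real Finset Matrix

variable {n : ℕ}

/-- The open simplicial cone `{Σ_k λ_k u^{(k)} : λ_k > 0}` spanned by the columns of an invertible matrix is a measurable set
(it is open: the image of the open orthant under a linear homeomorphism). Plumbing for "the cones of maximal dimension … other cones …
only describe measure zero subsets". [cite: Borinsky2020, proof of Theorem 19 (tropical.tex l.805–809); Lemma 17 (l.742–746)] -/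
theorem measurableSet_coneMap_image {U : Matrix (Fin n) (Fin n) ℝ} (hU : U.det ≠ 0) :
    MeasurableSet (coneMap U '' orthant n) :=
  measurableSet_orthant.image_of_continuousOn_injOn (coneMap U).continuous.continuousOn (injOn_coneMap hU)

/-- `⟨(y, 0), v⟩ = Σ_{i<n} y_i v_i`: the pairing of a chart representative (last coordinate `0`) with a vector of `ℝ^{n+1}`. Plumbing.
[cite: Borinsky2020, Remark 18 (tropical.tex l.754–759)] -/
theorem snoc_zero_dotProduct (y : Fin n → ℝ) (v : Fin (n + 1) → ℝ) :
    Fin.snoc (α := fun _ => ℝ) y 0 ⬝ᵥ v = ∑ i, y i * v (Fin.castSucc i) := by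
  simp [dotProduct, Fin.sum_univ_castSucc]

/-- A column of an invertible matrix is not zero ("linear independent vectors u^{(1)}, …"). Plumbing.
[cite: Borinsky2020, Lemma 17 (tropical.tex l.742–746)] -/
theorem exists_apply_ne_zero_of_det_ne_zero {U : Matrix (Fin n) (Fin n) ℝ} (hU : U.det ≠ 0) (k : Fin n) :
    ∃ i, U i k ≠ 0 := by
  by_contra h
  push Not at h
  exact hU (Matrix.det_eq_zero_of_column_eq_zero k h)

/-- **Remark 18 / the prefactor of Theorem 19**: for generators represented with last coordinate `0` — column `k` of `U` bordered by a `0` —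
the printed determinant `det(u^{(𝒞,1)}, …, u^{(𝒞,n−1)}, 𝟙)` (generators as columns, then the all-ones column) equals `det U`
(Laplace expansion along the last row). [cite: Borinsky2020, Theorem 19 eq. (evalCintegral) (tropical.tex l.786–801); Remark 18 (l.754–759); Lemma 17 (l.745)] -/
theorem det_border_one (U : Matrix (Fin n) (Fin n) ℝ) :
    (Matrix.of fun (m : Fin (n + 1)) (j : Fin (n + 1)) =>
        Fin.snoc (α := fun _ => ℝ) (fun k : Fin n => Fin.snoc (α := fun _ => ℝ) (fun i : Fin n => U i k) 0 m) 1 j).det =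
      U.det := by
  rw [Matrix.det_succ_row _ (Fin.last n)]
  rw [Fin.sum_univ_castSucc]
  have hzero : ∀ k : Fin n, (Matrix.of fun (m : Fin (n + 1)) (j : Fin (n + 1)) =>
      Fin.snoc (α := fun _ => ℝ) (fun k : Fin n => Fin.snoc (α := fun _ => ℝ) (fun i : Fin n => U i k) 0 m) 1 j)
      (Fin.last n) (Fin.castSucc k) = 0 := by
    intro k
    simp
  simp only [hzero, mul_zero, zero_mul, Finset.sum_const_zero, zero_add]
  have hlast : (Matrix.of fun (m : Fin (n + 1)) (j : Fin (n + 1)) =>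
      Fin.snoc (α := fun _ => ℝ) (fun k : Fin n => Fin.snoc (α := fun _ => ℝ) (fun i : Fin n => U i k) 0 m) 1 j)
      (Fin.last n) (Fin.last n) = 1 := by simp
  rw [hlast, mul_one]
  have hsign : (-1 : ℝ) ^ ((Fin.last n : ℕ) + (Fin.last n : ℕ)) = 1 := by
    rw [← two_mul, pow_mul]; simp
  rw [hsign, one_mul]
  congr 1
  ext i k
  simp [Matrix.submatrix, Fin.succAbove_last]

end Cones

section Main

open MeasureTheory Real Finset Matrix MvPolynomial

open scoped Pointwise

variable {n : ℕ} {ι κ : Type*} [Fintype ι] [Fintype κ]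
  (a : ι → MvPolynomial (Fin (n + 1)) ℝ) (b : κ → MvPolynomial (Fin (n + 1)) ℝ) (ν : ι → ℝ) (ρ : κ → ℝ)
  {𝓒 : Type*} [Fintype 𝓒]

/-- **Theorem 19, last item: "the prefactor |det(u^{(𝒞,1)}, …, u^{(𝒞,n−1)}, 𝟙)| / Π_k ⟨u^{(𝒞,k)}, w^{(𝒞)}⟩ is finite and positive"** — its
mechanism: under the gap of Lemma 15 every generator of a cone `𝒞` on which `w_𝒜^{(𝒞)}`, `w_ℬ^{(𝒞)}` are the maximisers pairs positively
with `w^{(𝒞)} = w_ℬ^{(𝒞)} − w_𝒜^{(𝒞)}` ("As ⟨y, w^{(𝒞)}⟩ > 0 for all y ∈ 𝒞 ∖ {0}, we also have ⟨u^{(𝒞,k)}, w^{(𝒞)}⟩ > 0"). Generators in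
chart coordinates (representatives with last coordinate `0`, Remark 18): column `k` of `U`.
[cite: Borinsky2020, Theorem 19 and its proof (tropical.tex l.776–822); Lemma 16 (l.702–710)] -/
theorem cone_pairing_pos_of_gap (ha : ∀ i, a i ≠ 0) (hb : ∀ j, b j ≠ 0) (hν : ∀ i, 0 ≤ ν i) (hρ : ∀ j, 0 ≤ ρ j)
    {ε : ℝ} (hε : 0 < ε)
    (hgap : ∀ y : Fin (n + 1) → ℝ, ∀ k k',
      ε * (y k - y k') ≤ (∑ j, ρ j * faceValue (b j) y) - ∑ i, ν i * faceValue (a i) y)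
    {U : Matrix (Fin n) (Fin n) ℝ} (hU : U.det ≠ 0) {wA wB : Fin (n + 1) → ℝ}
    (hwA : wA ∈ ∑ i, ν i • NP⟦a i⟧) (hwB : wB ∈ ∑ j, ρ j • NP⟦b j⟧)
    (hmaxA : ∀ l : Fin n → ℝ, (∀ k, 0 ≤ l k) → ∀ v ∈ ∑ i, ν i • NP⟦a i⟧,
      Fin.snoc (α := fun _ => ℝ) (U *ᵥ l) 0 ⬝ᵥ v ≤ Fin.snoc (α := fun _ => ℝ) (U *ᵥ l) 0 ⬝ᵥ wA)
    (hmaxB : ∀ l : Fin n → ℝ, (∀ k, 0 ≤ l k) → ∀ v ∈ ∑ j, ρ j • NP⟦b j⟧,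
      Fin.snoc (α := fun _ => ℝ) (U *ᵥ l) 0 ⬝ᵥ v ≤ Fin.snoc (α := fun _ => ℝ) (U *ᵥ l) 0 ⬝ᵥ wB)
    (k : Fin n) :
    0 < Fin.snoc (α := fun _ => ℝ) (fun i => U i k) 0 ⬝ᵥ (wB - wA) := by
  -- the generator `u^{(k)} = U e_k` lies in the closed cone
  have hl : ∀ k', 0 ≤ (Pi.single k 1 : Fin n → ℝ) k' := fun k' => by
    by_cases h : k' = k
    · subst h; simp
    · simp [h]
  have hcol : U *ᵥ (Pi.single k 1 : Fin n → ℝ) = fun i => U i k := by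
    funext i
    simp [Matrix.mulVec, dotProduct, Pi.single_apply]
  have hA := hmaxA (Pi.single k 1) hl
  have hB := hmaxB (Pi.single k 1) hl
  rw [hcol] at hA hB
  obtain ⟨i, hi⟩ := exists_apply_ne_zero_of_det_ne_zero hU k
  rcases lt_or_gt_of_ne hi with hneg | hpos
  · refine dotProduct_sub_pos_of_gap a b ν ρ ha hb hν hρ hε hgap hwA hwB hA hB
      (k := Fin.last n) (k' := Fin.castSucc i) ?_
    simpa using hneg
  · refine dotProduct_sub_pos_of_gap a b ν ρ ha hb hν hρ hε hgap hwA hwB hA hB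
      (k := Fin.castSucc i) (k' := Fin.last n) ?_
    simpa using hpos

/-- **Theorem 19 (Geometric sector decomposition)**, in the chart `x_n = 1` of eq. (integral_euler_mellin), `x = e^{(y,0)}`, `y ∈ ℝⁿ`.
DATA: a finite family `𝒞 ∈ 𝓜` of simplicial cones, cone `𝒞` spanned by the columns `u^{(𝒞,1)}, …, u^{(𝒞,n)}` of an invertible matrix `U_𝒞`
(generators in chart coordinates = representatives with last coordinate `0`, Remark 18), whose open cones `{U_𝒞 λ : λ > 0}` cover `ℝⁿ` up
to a null set and are pairwise a.e. disjoint ("The fan … is complete, i.e. it corresponds to a partition … it is enough to only consider the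
cones of maximal dimension … as other cones … only describe measure zero subsets"), and on each CLOSED cone points `w_𝒜^{(𝒞)} ∈ 𝒜`,
`w_ℬ^{(𝒞)} ∈ ℬ` maximising `⟨y, ·⟩` for all `y ∈ 𝒞` (the cone refines the common refinement of the normal fans of `𝒜` and `ℬ`).
CONCLUSION, for every bounded measurable `f`: "I[f] = ∫ (Π_i a_i^tr(x)^{Re ν_i}/Π_j b_j^tr(x)^{Re ρ_j}) f(x) Ω = Σ_{𝒞∈𝓜} I_𝒞[f] with
I_𝒞[f] = |det(u^{(𝒞,1)}, …, u^{(𝒞,n−1)}, 𝟙)| / Π_k ⟨u^{(𝒞,k)}, w^{(𝒞)}⟩ · ∫_{[0,1]^{n−1}} f(x^{(𝒞)}(ξ)) Π dξ_k", `w^{(𝒞)} = w_ℬ^{(𝒞)} − w_𝒜^{(𝒞)}`,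
"x_k^{(𝒞)} = Π_i ξ_i^{−u_k^{(𝒞,i)}/⟨u^{(𝒞,i)}, w^{(𝒞)}⟩}" — here `|det(…, 𝟙)| = |det U_𝒞|` (`det_border_one`) and `⟨u^{(𝒞,k)}, w^{(𝒞)}⟩ =
⟨(u^{(𝒞,k)}, 0), w^{(𝒞)}⟩`. The gap of Lemma 15 (R1 ∧ R2, `ConvergenceTheorem.ball_of_R1_R2` / `gap_of_ball`) is the hypothesis; no R3 and no
homogeneity of `f` are needed in the chart. [cite: Borinsky2020, Theorem 19 and its proof (tropical.tex l.776–822) (= AIHPD 10 (2023) Thm 4.5); Lemma 16 (l.702–722); Lemma 17 (l.742–774); eq. (integral_euler_mellin) (l.237–241)] -/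
theorem integral_tropical_mul_eq_sum_cones_of_gap (ha : ∀ i, a i ≠ 0) (hb : ∀ j, b j ≠ 0) (hν : ∀ i, 0 ≤ ν i)
    (hρ : ∀ j, 0 ≤ ρ j) {ε : ℝ} (hε : 0 < ε)
    (hgap : ∀ y : Fin (n + 1) → ℝ, ∀ k k',
      ε * (y k - y k') ≤ (∑ j, ρ j * faceValue (b j) y) - ∑ i, ν i * faceValue (a i) y)
    (U : 𝓒 → Matrix (Fin n) (Fin n) ℝ) (hU : ∀ C, (U C).det ≠ 0)
    (hcover : volume (⋃ C, coneMap (U C) '' orthant n)ᶜ = 0)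
    (hdisj : Pairwise fun C C' => AEDisjoint volume (coneMap (U C) '' orthant n) (coneMap (U C') '' orthant n))
    (wA wB : 𝓒 → Fin (n + 1) → ℝ)
    (hwA : ∀ C, wA C ∈ ∑ i, ν i • NP⟦a i⟧) (hwB : ∀ C, wB C ∈ ∑ j, ρ j • NP⟦b j⟧)
    (hmaxA : ∀ C (l : Fin n → ℝ), (∀ k, 0 ≤ l k) → ∀ v ∈ ∑ i, ν i • NP⟦a i⟧,
      Fin.snoc (α := fun _ => ℝ) (U C *ᵥ l) 0 ⬝ᵥ v ≤ Fin.snoc (α := fun _ => ℝ) (U C *ᵥ l) 0 ⬝ᵥ wA C)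
    (hmaxB : ∀ C (l : Fin n → ℝ), (∀ k, 0 ≤ l k) → ∀ v ∈ ∑ j, ρ j • NP⟦b j⟧,
      Fin.snoc (α := fun _ => ℝ) (U C *ᵥ l) 0 ⬝ᵥ v ≤ Fin.snoc (α := fun _ => ℝ) (U C *ᵥ l) 0 ⬝ᵥ wB C)
    (f : (Fin (n + 1) → ℝ) → ℝ) (hfm : Measurable f) (hfb : ∃ B, ∀ x, |f x| ≤ B) :
    ∫ y : Fin n → ℝ, (∏ i, trop (a i) (fun k => exp (Fin.snoc (α := fun _ => ℝ) y 0 k)) ^ ν i) /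
        (∏ j, trop (b j) (fun k => exp (Fin.snoc (α := fun _ => ℝ) y 0 k)) ^ ρ j) *
        f (fun k => exp (Fin.snoc (α := fun _ => ℝ) y 0 k)) =
      ∑ C, |(U C).det| * (∏ k, 1 / (Fin.snoc (α := fun _ => ℝ) (fun i => U C i k) 0 ⬝ᵥ (wB C - wA C))) *
        ∫ ξ in unitCube n, f (fun m => ∏ k, ξ k ^
          (-(Fin.snoc (α := fun _ => ℝ) (fun i => U C i k) 0 m) / (Fin.snoc (α := fun _ => ℝ) (fun i => U C i k) 0 ⬝ᵥ (wB C - wA C)))) := by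
  set T : (Fin n → ℝ) → ℝ := fun y => (∏ i, trop (a i) (fun k => exp (Fin.snoc (α := fun _ => ℝ) y 0 k)) ^ ν i) /
    ∏ j, trop (b j) (fun k => exp (Fin.snoc (α := fun _ => ℝ) y 0 k)) ^ ρ j with hT
  set F : (Fin n → ℝ) → ℝ := fun y => f (fun k => exp (Fin.snoc (α := fun _ => ℝ) y 0 k)) with hF
  set S : 𝓒 → Set (Fin n → ℝ) := fun C => coneMap (U C) '' orthant n with hS
  -- the exponent vector `w^{(C)} = w_ℬ − w_𝒜` read on the chart, and the pairings `c_k = ⟨u^{(C,k)}, w^{(C)}⟩`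
  set w : 𝓒 → Fin n → ℝ := fun C i => (wB C - wA C) (Fin.castSucc i) with hw
  set c : 𝓒 → Fin n → ℝ := fun C k => ∑ i, w C i * U C i k with hc
  have hcdot : ∀ C k, Fin.snoc (α := fun _ => ℝ) (fun i => U C i k) 0 ⬝ᵥ (wB C - wA C) = c C k := by
    intro C k
    rw [snoc_zero_dotProduct]
    simp only [hc, hw]
    exact Finset.sum_congr rfl fun i _ => mul_comm _ _
  have hcpos : ∀ C k, 0 < c C k := fun C k => by
    rw [← hcdot]
    exact cone_pairing_pos_of_gap a b ν ρ ha hb hν hρ hε hgap (hU C) (hwA C) (hwB C) (hmaxA C) (hmaxB C) k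
  -- integrability of `T · F` on the chart
  have hTint : Integrable T := integrable_tropical_of_gap a b ν ρ ha hb hε hgap
  obtain ⟨B, hB⟩ := hfb
  have hFm : AEStronglyMeasurable F volume := (hfm.comp continuous_expSnoc.measurable).aestronglyMeasurable
  have hH : Integrable (fun y => T y * F y) :=
    hTint.mul_bdd hFm (Filter.Eventually.of_forall fun y => by rw [Real.norm_eq_abs]; exact hB _)
  -- Step 1: the cones cover the chart up to a null set
  have hae : ∀ᵐ y ∂(volume : Measure (Fin n → ℝ)), y ∈ ⋃ C, S C := by
    rw [ae_iff]
    simpa only [Set.compl_def] using hcover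
  have step1 : ∫ y, T y * F y = ∫ y in ⋃ C, S C, T y * F y := integral_eq_setIntegral hae _
  -- Step 2: "I = Σ_C I_C"
  have hSm : ∀ C, MeasurableSet (S C) := fun C => measurableSet_coneMap_image (hU C)
  have step2 : ∫ y in ⋃ C, S C, T y * F y = ∑ C, ∫ y in S C, T y * F y := by
    rw [integral_iUnion_ae (fun C => (hSm C).nullMeasurableSet) hdisj hH.integrableOn, tsum_fintype]
  -- Step 3: on each cone, Lemma 16 then Lemma 17
  have step3 : ∀ C, ∫ y in S C, T y * F y =
      |(U C).det| * (∏ k, 1 / c C k) * ∫ ξ in unitCube n, F (U C *ᵥ logMap (c C) ξ) := by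
    intro C
    have hcong : ∀ y ∈ S C, T y * F y = F y * exp (-∑ i, w C i * y i) := by
      rintro y ⟨l, hl, rfl⟩
      have hl' : ∀ k, 0 ≤ l k := fun k => (mem_orthant.mp hl k).le
      simp only [hT, hF, coneMap_apply]
      rw [prod_trop_rpow_div_eq_exp_neg_dotProduct_of_isMaxOn a b ν ρ ha hb hν hρ (hwA C) (hwB C) (hmaxA C l hl')
        (hmaxB C l hl'), snoc_zero_dotProduct, mul_comm]
      have hsum : ∑ i, (U C *ᵥ l) i * (wB C - wA C) (Fin.castSucc i) =
          ∑ i, (wB C - wA C) (Fin.castSucc i) * (U C *ᵥ l) i := Finset.sum_congr rfl fun i _ => mul_comm _ _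
      rw [hsum]
    rw [setIntegral_congr_fun (hSm C) hcong]
    exact integral_cone_mul_exp_neg_eq_unitCube (hU C) (w C) (hcpos C) F
  -- Step 4: the printed sample point `x^{(C)}(ξ)`
  have step4 : ∀ C, ∫ ξ in unitCube n, F (U C *ᵥ logMap (c C) ξ) = ∫ ξ in unitCube n, f (fun m => ∏ k, ξ k ^
      (-(Fin.snoc (α := fun _ => ℝ) (fun i => U C i k) 0 m) / (Fin.snoc (α := fun _ => ℝ) (fun i => U C i k) 0 ⬝ᵥ (wB C - wA C)))) := by
    intro C
    refine setIntegral_congr_fun measurableSet_unitCube fun ξ hξ => ?_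
    simp only [hF]
    congr 1
    funext m
    refine Fin.lastCases ?_ (fun i => ?_) m
    · simp only [Fin.snoc_last, exp_zero, neg_zero, zero_div, Real.rpow_zero, Finset.prod_const_one]
    · simp only [Fin.snoc_castSucc, hcdot]
      rw [Matrix.mulVec, dotProduct, exp_sum]
      refine Finset.prod_congr rfl fun k _ => ?_
      rw [Real.rpow_def_of_pos ((mem_unitCube.mp hξ) k).1, logMap]
      congr 1
      field_simp
  -- assemble
  rw [step1, step2]
  refine Finset.sum_congr rfl fun C _ => ?_
  rw [step3 C, step4 C]
  simp only [hcdot]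

/-- **Theorem 19 under R1 ∧ R2 as printed** (homogeneous denominators): R1 ("ℬ is (n−1)-dimensional", on the direction of its affine hull)
and R2 ("𝒜 ⊂ relint ℬ") give the gap of Lemma 15 (`ConvergenceTheorem.ball_of_R1_R2`, `gap_of_ball`), hence the sector decomposition of
`integral_tropical_mul_eq_sum_cones_of_gap`. [cite: Borinsky2020, Theorem 19 (tropical.tex l.776–802); Theorem 3, R1/R2 (l.323–326); Lemma 15 (l.669–688)] -/
theorem integral_tropical_mul_eq_sum_cones_of_R1_R2 (ha : ∀ i, a i ≠ 0) (hb : ∀ j, b j ≠ 0) (hν : ∀ i, 0 ≤ ν i)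
    (hρ : ∀ j, 0 ≤ ρ j) {db : κ → ℕ} (hhb : ∀ j, (b j).IsHomogeneous (db j))
    (hR1 : Module.finrank ℝ (vectorSpan ℝ (∑ j, ρ j • NP⟦b j⟧)) = n)
    (hR2 : (∑ i, ν i • NP⟦a i⟧) ⊆ intrinsicInterior ℝ (∑ j, ρ j • NP⟦b j⟧))
    (U : 𝓒 → Matrix (Fin n) (Fin n) ℝ) (hU : ∀ C, (U C).det ≠ 0)
    (hcover : volume (⋃ C, coneMap (U C) '' orthant n)ᶜ = 0)
    (hdisj : Pairwise fun C C' => AEDisjoint volume (coneMap (U C) '' orthant n) (coneMap (U C') '' orthant n))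
    (wA wB : 𝓒 → Fin (n + 1) → ℝ)
    (hwA : ∀ C, wA C ∈ ∑ i, ν i • NP⟦a i⟧) (hwB : ∀ C, wB C ∈ ∑ j, ρ j • NP⟦b j⟧)
    (hmaxA : ∀ C (l : Fin n → ℝ), (∀ k, 0 ≤ l k) → ∀ v ∈ ∑ i, ν i • NP⟦a i⟧,
      Fin.snoc (α := fun _ => ℝ) (U C *ᵥ l) 0 ⬝ᵥ v ≤ Fin.snoc (α := fun _ => ℝ) (U C *ᵥ l) 0 ⬝ᵥ wA C)
    (hmaxB : ∀ C (l : Fin n → ℝ), (∀ k, 0 ≤ l k) → ∀ v ∈ ∑ j, ρ j • NP⟦b j⟧,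
      Fin.snoc (α := fun _ => ℝ) (U C *ᵥ l) 0 ⬝ᵥ v ≤ Fin.snoc (α := fun _ => ℝ) (U C *ᵥ l) 0 ⬝ᵥ wB C)
    (f : (Fin (n + 1) → ℝ) → ℝ) (hfm : Measurable f) (hfb : ∃ B, ∀ x, |f x| ≤ B) :
    ∫ y : Fin n → ℝ, (∏ i, trop (a i) (fun k => exp (Fin.snoc (α := fun _ => ℝ) y 0 k)) ^ ν i) /
        (∏ j, trop (b j) (fun k => exp (Fin.snoc (α := fun _ => ℝ) y 0 k)) ^ ρ j) *
        f (fun k => exp (Fin.snoc (α := fun _ => ℝ) y 0 k)) =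
      ∑ C, |(U C).det| * (∏ k, 1 / (Fin.snoc (α := fun _ => ℝ) (fun i => U C i k) 0 ⬝ᵥ (wB C - wA C))) *
        ∫ ξ in unitCube n, f (fun m => ∏ k, ξ k ^
          (-(Fin.snoc (α := fun _ => ℝ) (fun i => U C i k) 0 m) / (Fin.snoc (α := fun _ => ℝ) (fun i => U C i k) 0 ⬝ᵥ (wB C - wA C)))) := by
  obtain ⟨δ, hδ, hball⟩ := ball_of_R1_R2 a b ν ρ ha hhb hR1 hR2
  exact integral_tropical_mul_eq_sum_cones_of_gap a b ν ρ ha hb hν hρ hδ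
    (fun y k k' => gap_of_ball a b ν ρ ha hρ hδ.le hball y k k') U hU hcover hdisj wA wB hwA hwB hmaxA hmaxB f hfm hfb

/-- **Eq. (def_Itr_secdec): `I^tr = Σ_{𝒞∈𝓜} I^tr_𝒞` with `I^tr_𝒞 = |det(u^{(𝒞,1)}, …, u^{(𝒞,n−1)}, 𝟙)| / Π_k ⟨u^{(𝒞,k)}, w^{(𝒞)}⟩`** ("By
Theorem 19 the tropically approximated integral in eq. (integral_trop) can be written as a sum") — Theorem 19 with `f ≡ 1`, for
`I^tr = ∫_{ℝⁿ} Π_i a_i^tr(e^{(y,0)})^{ν_i}/Π_j b_j^tr(e^{(y,0)})^{ρ_j} dy`, the normalisation of `μ^tr` in the chart `x_n = 1`.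
[cite: Borinsky2020, eq. (def_Itr_secdec) (tropical.tex l.918–920) (= AIHPD 10 (2023) eq. (5.3)); Theorem 19 (l.776–802); eq. (integral_trop) (l.887)] -/
theorem integral_tropical_eq_sum_cones_of_gap (ha : ∀ i, a i ≠ 0) (hb : ∀ j, b j ≠ 0) (hν : ∀ i, 0 ≤ ν i)
    (hρ : ∀ j, 0 ≤ ρ j) {ε : ℝ} (hε : 0 < ε)
    (hgap : ∀ y : Fin (n + 1) → ℝ, ∀ k k',
      ε * (y k - y k') ≤ (∑ j, ρ j * faceValue (b j) y) - ∑ i, ν i * faceValue (a i) y)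
    (U : 𝓒 → Matrix (Fin n) (Fin n) ℝ) (hU : ∀ C, (U C).det ≠ 0)
    (hcover : volume (⋃ C, coneMap (U C) '' orthant n)ᶜ = 0)
    (hdisj : Pairwise fun C C' => AEDisjoint volume (coneMap (U C) '' orthant n) (coneMap (U C') '' orthant n))
    (wA wB : 𝓒 → Fin (n + 1) → ℝ)
    (hwA : ∀ C, wA C ∈ ∑ i, ν i • NP⟦a i⟧) (hwB : ∀ C, wB C ∈ ∑ j, ρ j • NP⟦b j⟧)
    (hmaxA : ∀ C (l : Fin n → ℝ), (∀ k, 0 ≤ l k) → ∀ v ∈ ∑ i, ν i • NP⟦a i⟧,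
      Fin.snoc (α := fun _ => ℝ) (U C *ᵥ l) 0 ⬝ᵥ v ≤ Fin.snoc (α := fun _ => ℝ) (U C *ᵥ l) 0 ⬝ᵥ wA C)
    (hmaxB : ∀ C (l : Fin n → ℝ), (∀ k, 0 ≤ l k) → ∀ v ∈ ∑ j, ρ j • NP⟦b j⟧,
      Fin.snoc (α := fun _ => ℝ) (U C *ᵥ l) 0 ⬝ᵥ v ≤ Fin.snoc (α := fun _ => ℝ) (U C *ᵥ l) 0 ⬝ᵥ wB C) :
    ∫ y : Fin n → ℝ, (∏ i, trop (a i) (fun k => exp (Fin.snoc (α := fun _ => ℝ) y 0 k)) ^ ν i) /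
        ∏ j, trop (b j) (fun k => exp (Fin.snoc (α := fun _ => ℝ) y 0 k)) ^ ρ j =
      ∑ C, |(U C).det| * ∏ k, 1 / (Fin.snoc (α := fun _ => ℝ) (fun i => U C i k) 0 ⬝ᵥ (wB C - wA C)) := by
  have h := integral_tropical_mul_eq_sum_cones_of_gap a b ν ρ ha hb hν hρ hε hgap U hU hcover hdisj wA wB hwA hwB hmaxA hmaxB
    (fun _ => 1) measurable_const ⟨1, fun _ => by simp⟩
  simp only [mul_one] at h
  rw [h]
  refine Finset.sum_congr rfl fun C _ => ?_
  rw [setIntegral_const, smul_eq_mul, mul_one]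
  have hvol : (volume : Measure (Fin n → ℝ)).real (unitCube n) = 1 := by
    rw [measureReal_def, unitCube, Real.volume_pi_Ioo]
    simp
  rw [hvol, mul_one]

/-- **"where `I^tr_𝒞 > 0` for all maximal cones"** (eq. (def_Itr_secdec)) — the sector value `|det U_𝒞| · Π_k 1/⟨u^{(𝒞,k)}, w^{(𝒞)}⟩` is
positive, so "we can interpret `I^tr_𝒞/I^tr` as a probability assigned to each cone" (Algorithm 3's first line).
[cite: Borinsky2020, eq. (def_Itr_secdec) and the sentence after it (tropical.tex l.918–921); Theorem 19, last item (l.800–801)] -/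
theorem cone_tropical_pos_of_gap (ha : ∀ i, a i ≠ 0) (hb : ∀ j, b j ≠ 0) (hν : ∀ i, 0 ≤ ν i) (hρ : ∀ j, 0 ≤ ρ j)
    {ε : ℝ} (hε : 0 < ε)
    (hgap : ∀ y : Fin (n + 1) → ℝ, ∀ k k',
      ε * (y k - y k') ≤ (∑ j, ρ j * faceValue (b j) y) - ∑ i, ν i * faceValue (a i) y)
    {U : Matrix (Fin n) (Fin n) ℝ} (hU : U.det ≠ 0) {wA wB : Fin (n + 1) → ℝ}
    (hwA : wA ∈ ∑ i, ν i • NP⟦a i⟧) (hwB : wB ∈ ∑ j, ρ j • NP⟦b j⟧)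
    (hmaxA : ∀ l : Fin n → ℝ, (∀ k, 0 ≤ l k) → ∀ v ∈ ∑ i, ν i • NP⟦a i⟧,
      Fin.snoc (α := fun _ => ℝ) (U *ᵥ l) 0 ⬝ᵥ v ≤ Fin.snoc (α := fun _ => ℝ) (U *ᵥ l) 0 ⬝ᵥ wA)
    (hmaxB : ∀ l : Fin n → ℝ, (∀ k, 0 ≤ l k) → ∀ v ∈ ∑ j, ρ j • NP⟦b j⟧,
      Fin.snoc (α := fun _ => ℝ) (U *ᵥ l) 0 ⬝ᵥ v ≤ Fin.snoc (α := fun _ => ℝ) (U *ᵥ l) 0 ⬝ᵥ wB) :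
    0 < |U.det| * ∏ k, 1 / (Fin.snoc (α := fun _ => ℝ) (fun i => U i k) 0 ⬝ᵥ (wB - wA)) :=
  mul_pos (abs_pos.mpr hU) (Finset.prod_pos fun k _ => one_div_pos.mpr
    (cone_pairing_pos_of_gap a b ν ρ ha hb hν hρ hε hgap hU hwA hwB hmaxA hmaxB k))

/-- **Proposition 21: Algorithm 3 generates samples distributed as `μ^tr` — expectation form, as in the printed proof.** Algorithm 3 ("Draw
a random cone 𝒞 ∈ 𝓜 with probability I^tr_𝒞/I^tr. Draw a random vector ξ ∈ [0,1]^{n−1} from the uniform distribution. Set x_k =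
Π_i ξ_i^{−u_k^{(𝒞,i)}/⟨u^{(𝒞,i)}, w^{(𝒞)}⟩} for all k. Return x = [x_1:…:x_n] ∈ Exp 𝒞 ⊂ ℙ^{n−1}_{>0} and 𝒞.") has, for every bounded
measurable test function `f`, "E[f(x)] = Σ_{𝒞∈𝓜} I^tr_𝒞/I^tr ∫_{[0,1]^{n−1}} f(x^{(𝒞)}(ξ)) Π dξ_k", and this equals `∫ f dμ^tr`, `μ^tr` the tropical
probability measure of eq. (mu_probability) — here on the chart `x_n = 1`, `x = e^{(y,0)}`, with Lebesgue density `T/I^tr` exactly as typed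
in `ConvergenceTheorem.isProbabilityMeasure_tropicalMeasure_of_gap` ("Using eq. (def_Itr_secdec) and Theorem 19 gives E[f(x)] = (1/I^tr) ∫
(Π_i a_i^tr^{Re ν_i}/Π_j b_j^tr^{Re ρ_j}) f Ω = ∫ f μ^tr"). [cite: Borinsky2020, Algorithm 3 (tropical.tex l.925–934); Proposition 21 and its proof (l.936–946) (= AIHPD 10 (2023) Prop. 5.1); eq. (mu_probability) (l.890–893)] -/
theorem algorithm3_expectation_eq_integral_tropicalMeasure (ha : ∀ i, a i ≠ 0) (hb : ∀ j, b j ≠ 0) (hν : ∀ i, 0 ≤ ν i)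
    (hρ : ∀ j, 0 ≤ ρ j) {ε : ℝ} (hε : 0 < ε)
    (hgap : ∀ y : Fin (n + 1) → ℝ, ∀ k k',
      ε * (y k - y k') ≤ (∑ j, ρ j * faceValue (b j) y) - ∑ i, ν i * faceValue (a i) y)
    (U : 𝓒 → Matrix (Fin n) (Fin n) ℝ) (hU : ∀ C, (U C).det ≠ 0)
    (hcover : volume (⋃ C, coneMap (U C) '' orthant n)ᶜ = 0)
    (hdisj : Pairwise fun C C' => AEDisjoint volume (coneMap (U C) '' orthant n) (coneMap (U C') '' orthant n))
    (wA wB : 𝓒 → Fin (n + 1) → ℝ)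
    (hwA : ∀ C, wA C ∈ ∑ i, ν i • NP⟦a i⟧) (hwB : ∀ C, wB C ∈ ∑ j, ρ j • NP⟦b j⟧)
    (hmaxA : ∀ C (l : Fin n → ℝ), (∀ k, 0 ≤ l k) → ∀ v ∈ ∑ i, ν i • NP⟦a i⟧,
      Fin.snoc (α := fun _ => ℝ) (U C *ᵥ l) 0 ⬝ᵥ v ≤ Fin.snoc (α := fun _ => ℝ) (U C *ᵥ l) 0 ⬝ᵥ wA C)
    (hmaxB : ∀ C (l : Fin n → ℝ), (∀ k, 0 ≤ l k) → ∀ v ∈ ∑ j, ρ j • NP⟦b j⟧,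
      Fin.snoc (α := fun _ => ℝ) (U C *ᵥ l) 0 ⬝ᵥ v ≤ Fin.snoc (α := fun _ => ℝ) (U C *ᵥ l) 0 ⬝ᵥ wB C)
    (f : (Fin (n + 1) → ℝ) → ℝ) (hfm : Measurable f) (hfb : ∃ B, ∀ x, |f x| ≤ B) :
    ∑ C, |(U C).det| * (∏ k, 1 / (Fin.snoc (α := fun _ => ℝ) (fun i => U C i k) 0 ⬝ᵥ (wB C - wA C))) /
          (∫ y' : Fin n → ℝ, (∏ i, trop (a i) (fun k => exp (Fin.snoc (α := fun _ => ℝ) y' 0 k)) ^ ν i) /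
            ∏ j, trop (b j) (fun k => exp (Fin.snoc (α := fun _ => ℝ) y' 0 k)) ^ ρ j) *
        ∫ ξ in unitCube n, f (fun m => ∏ k, ξ k ^
          (-(Fin.snoc (α := fun _ => ℝ) (fun i => U C i k) 0 m) / (Fin.snoc (α := fun _ => ℝ) (fun i => U C i k) 0 ⬝ᵥ (wB C - wA C)))) =
      ∫ y : Fin n → ℝ, f (fun k => exp (Fin.snoc (α := fun _ => ℝ) y 0 k))
        ∂((volume : Measure (Fin n → ℝ)).withDensity fun y => ENNReal.ofReal
          (((∏ i, trop (a i) (fun k => exp (Fin.snoc (α := fun _ => ℝ) y 0 k)) ^ ν i) /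
              ∏ j, trop (b j) (fun k => exp (Fin.snoc (α := fun _ => ℝ) y 0 k)) ^ ρ j) /
            ∫ y' : Fin n → ℝ, (∏ i, trop (a i) (fun k => exp (Fin.snoc (α := fun _ => ℝ) y' 0 k)) ^ ν i) /
              ∏ j, trop (b j) (fun k => exp (Fin.snoc (α := fun _ => ℝ) y' 0 k)) ^ ρ j)) := by
  set T : (Fin n → ℝ) → ℝ := fun y => (∏ i, trop (a i) (fun k => exp (Fin.snoc (α := fun _ => ℝ) y 0 k)) ^ ν i) /
    ∏ j, trop (b j) (fun k => exp (Fin.snoc (α := fun _ => ℝ) y 0 k)) ^ ρ j with hT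
  have hI : 0 < ∫ y, T y := integral_tropical_pos_of_gap a b ν ρ ha hb hε hgap
  have hTm : Measurable T := by
    have h : T = fun y => exp ((∑ i, ν i * faceValue (a i) (Fin.snoc (α := fun _ => ℝ) y 0)) -
        ∑ j, ρ j * faceValue (b j) (Fin.snoc (α := fun _ => ℝ) y 0)) :=
      funext fun y => prod_trop_rpow_div_eq_exp a b ν ρ ha hb _
    rw [h]
    have hsnoc : Continuous fun y : Fin n → ℝ => (Fin.snoc (α := fun _ => ℝ) y 0 : Fin (n + 1) → ℝ) := by
      refine continuous_pi fun k => ?_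
      refine Fin.lastCases ?_ (fun i => ?_) k
      · simp only [Fin.snoc_last]
        exact continuous_const
      · simp only [Fin.snoc_castSucc]
        exact continuous_apply i
    exact (continuous_exp.comp (((continuous_finsetSum _ fun i _ =>
        continuous_const.mul ((continuous_faceValue (ha i)).comp hsnoc))).sub
      (continuous_finsetSum _ fun j _ => continuous_const.mul ((continuous_faceValue (hb j)).comp hsnoc)))).measurable
  have hT0 : ∀ y, 0 ≤ T y := fun y =>
    (div_pos (Finset.prod_pos fun i _ => Real.rpow_pos_of_pos (trop_pos (fun _ => exp_pos _) (ha i)) _)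
      (Finset.prod_pos fun j _ => Real.rpow_pos_of_pos (trop_pos (fun _ => exp_pos _) (hb j)) _)).le
  have key := integral_mul_eq_integral_mul_integral_withDensity (vol := (volume : Measure (Fin n → ℝ))) hTm hT0 hI
    (fun y => f (fun k => exp (Fin.snoc (α := fun _ => ℝ) y 0 k)))
  -- `∫ f dμ^tr = (∫ T f) / I^tr`
  have hrhs : ∫ y : Fin n → ℝ, f (fun k => exp (Fin.snoc (α := fun _ => ℝ) y 0 k))
        ∂((volume : Measure (Fin n → ℝ)).withDensity fun y => ENNReal.ofReal (T y / ∫ y', T y')) =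
      (∫ y, T y * f (fun k => exp (Fin.snoc (α := fun _ => ℝ) y 0 k))) / ∫ y, T y := by
    rw [key, mul_div_cancel_left₀ _ hI.ne']
  rw [hrhs, integral_tropical_mul_eq_sum_cones_of_gap a b ν ρ ha hb hν hρ hε hgap U hU hcover hdisj wA wB hwA hwB hmaxA hmaxB
    f hfm hfb, Finset.sum_div]
  refine Finset.sum_congr rfl fun C _ => ?_
  ring

/-- **Proposition 21 as an identity of measures ("generates a sample x ∈ ℙ^{n−1}_{>0}, distributed as μ^tr").** The law of Algorithm 3's
output `x`, read in the chart `x_n = 1` through `x ↦ (log(x_j/x_n))_{j<n}` — the finite mixture over the maximal cones `𝒞 ∈ 𝓜` with weights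
`I^tr_𝒞/I^tr` of the images of the uniform law on `[0,1]^n` under `ξ ↦ (log(x^{(𝒞)}(ξ)_j / x^{(𝒞)}(ξ)_n))_{j<n}` — IS the tropical
probability measure `μ^tr` of eq. (mu_probability) (Lebesgue density `T/I^tr` on the chart, as in `ConvergenceTheorem.lean`): the input law
`μ` that `TropicalSamplingEstimator.lean` takes abstractly, now for a GENERAL simplicial fan (the generalized-permutahedron case, Algorithm 4,
is `GeneralizedPermutahedronSampling.algorithm4_law_eq_tropicalMeasure`). [cite: Borinsky2020, Proposition 21 (tropical.tex l.936–938) (= AIHPD 10 (2023) Prop. 5.1); Algorithm 3 (l.925–934); eq. (mu_probability) (l.890–893)] -/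
theorem algorithm3_law_eq_tropicalMeasure (ha : ∀ i, a i ≠ 0) (hb : ∀ j, b j ≠ 0) (hν : ∀ i, 0 ≤ ν i)
    (hρ : ∀ j, 0 ≤ ρ j) {ε : ℝ} (hε : 0 < ε)
    (hgap : ∀ y : Fin (n + 1) → ℝ, ∀ k k',
      ε * (y k - y k') ≤ (∑ j, ρ j * faceValue (b j) y) - ∑ i, ν i * faceValue (a i) y)
    (U : 𝓒 → Matrix (Fin n) (Fin n) ℝ) (hU : ∀ C, (U C).det ≠ 0)
    (hcover : volume (⋃ C, coneMap (U C) '' orthant n)ᶜ = 0)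
    (hdisj : Pairwise fun C C' => AEDisjoint volume (coneMap (U C) '' orthant n) (coneMap (U C') '' orthant n))
    (wA wB : 𝓒 → Fin (n + 1) → ℝ)
    (hwA : ∀ C, wA C ∈ ∑ i, ν i • NP⟦a i⟧) (hwB : ∀ C, wB C ∈ ∑ j, ρ j • NP⟦b j⟧)
    (hmaxA : ∀ C (l : Fin n → ℝ), (∀ k, 0 ≤ l k) → ∀ v ∈ ∑ i, ν i • NP⟦a i⟧,
      Fin.snoc (α := fun _ => ℝ) (U C *ᵥ l) 0 ⬝ᵥ v ≤ Fin.snoc (α := fun _ => ℝ) (U C *ᵥ l) 0 ⬝ᵥ wA C)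
    (hmaxB : ∀ C (l : Fin n → ℝ), (∀ k, 0 ≤ l k) → ∀ v ∈ ∑ j, ρ j • NP⟦b j⟧,
      Fin.snoc (α := fun _ => ℝ) (U C *ᵥ l) 0 ⬝ᵥ v ≤ Fin.snoc (α := fun _ => ℝ) (U C *ᵥ l) 0 ⬝ᵥ wB C) :
    (∑ C, ENNReal.ofReal (|(U C).det| * (∏ k, 1 / (Fin.snoc (α := fun _ => ℝ) (fun i => U C i k) 0 ⬝ᵥ (wB C - wA C))) /
          (∫ y' : Fin n → ℝ, (∏ i, trop (a i) (fun k => exp (Fin.snoc (α := fun _ => ℝ) y' 0 k)) ^ ν i) /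
            ∏ j, trop (b j) (fun k => exp (Fin.snoc (α := fun _ => ℝ) y' 0 k)) ^ ρ j)) •
        ((volume : Measure (Fin n → ℝ)).restrict (unitCube n)).map (fun ξ : Fin n → ℝ => fun j : Fin n =>
          Real.log (∏ k, ξ k ^ (-(Fin.snoc (α := fun _ => ℝ) (fun i => U C i k) 0 (Fin.castSucc j)) /
              (Fin.snoc (α := fun _ => ℝ) (fun i => U C i k) 0 ⬝ᵥ (wB C - wA C)))) -
          Real.log (∏ k, ξ k ^ (-(Fin.snoc (α := fun _ => ℝ) (fun i => U C i k) 0 (Fin.last n)) /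
              (Fin.snoc (α := fun _ => ℝ) (fun i => U C i k) 0 ⬝ᵥ (wB C - wA C)))))) =
      (volume : Measure (Fin n → ℝ)).withDensity fun y => ENNReal.ofReal
          (((∏ i, trop (a i) (fun k => exp (Fin.snoc (α := fun _ => ℝ) y 0 k)) ^ ν i) /
              ∏ j, trop (b j) (fun k => exp (Fin.snoc (α := fun _ => ℝ) y 0 k)) ^ ρ j) /
            ∫ y' : Fin n → ℝ, (∏ i, trop (a i) (fun k => exp (Fin.snoc (α := fun _ => ℝ) y' 0 k)) ^ ν i) /
              ∏ j, trop (b j) (fun k => exp (Fin.snoc (α := fun _ => ℝ) y' 0 k)) ^ ρ j) := by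
  set T : (Fin n → ℝ) → ℝ := fun y => (∏ i, trop (a i) (fun k => exp (Fin.snoc (α := fun _ => ℝ) y 0 k)) ^ ν i) /
    ∏ j, trop (b j) (fun k => exp (Fin.snoc (α := fun _ => ℝ) y 0 k)) ^ ρ j with hT
  set μtr : Measure (Fin n → ℝ) := (volume : Measure (Fin n → ℝ)).withDensity fun y => ENNReal.ofReal (T y / ∫ y', T y')
    with hμtr
  set p : 𝓒 → ℝ := fun C => |(U C).det| * (∏ k, 1 / (Fin.snoc (α := fun _ => ℝ) (fun i => U C i k) 0 ⬝ᵥ (wB C - wA C))) /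
    ∫ y', T y' with hp
  -- the chart `x ↦ (log x_j − log x_n)_j` and the sample maps `ξ ↦ x^{(C)}(ξ)`
  set chart : (Fin (n + 1) → ℝ) → (Fin n → ℝ) := fun x j => Real.log (x (Fin.castSucc j)) - Real.log (x (Fin.last n))
    with hchart
  set X : 𝓒 → (Fin n → ℝ) → (Fin (n + 1) → ℝ) := fun C ξ m => ∏ k, ξ k ^
    (-(Fin.snoc (α := fun _ => ℝ) (fun i => U C i k) 0 m) / (Fin.snoc (α := fun _ => ℝ) (fun i => U C i k) 0 ⬝ᵥ (wB C - wA C)))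
    with hX
  have hchartm : Measurable chart :=
    measurable_pi_lambda _ fun j => ((Real.measurable_log.comp (measurable_pi_apply _)).sub
      (Real.measurable_log.comp (measurable_pi_apply _)))
  have hXm : ∀ C, Measurable (X C) := fun C =>
    measurable_pi_lambda _ fun m => Finset.measurable_prod _ fun k _ => (measurable_pi_apply k).pow_const _
  have hgm : ∀ C, Measurable (fun ξ => chart (X C ξ)) := fun C => hchartm.comp (hXm C)
  have hI : 0 < ∫ y, T y := integral_tropical_pos_of_gap a b ν ρ ha hb hε hgap
  have hp0 : ∀ C, 0 ≤ p C := fun C =>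
    (div_pos (cone_tropical_pos_of_gap a b ν ρ ha hb hν hρ hε hgap (hU C) (hwA C) (hwB C) (hmaxA C) (hmaxB C)) hI).le
  haveI : IsProbabilityMeasure μtr := isProbabilityMeasure_tropicalMeasure_of_gap a b ν ρ ha hb hε hgap
  change (∑ C, ENNReal.ofReal (p C) • ((volume : Measure (Fin n → ℝ)).restrict (unitCube n)).map (fun ξ => chart (X C ξ))) = μtr
  ext s hs
  -- evaluate both sides on `s` through the expectation of the test function `𝟙_s ∘ chart`
  set f : (Fin (n + 1) → ℝ) → ℝ := fun x => s.indicator (1 : (Fin n → ℝ) → ℝ) (chart x) with hf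
  have hfm : Measurable f := (measurable_one.indicator hs).comp hchartm
  have hf1 : ∀ x, |f x| ≤ 1 := by
    intro x
    simp only [hf]
    by_cases hx : chart x ∈ s
    · rw [Set.indicator_of_mem hx]; simp
    · rw [Set.indicator_of_notMem hx]; simp
  have key := algorithm3_expectation_eq_integral_tropicalMeasure a b ν ρ ha hb hν hρ hε hgap U hU hcover hdisj wA wB hwA hwB
    hmaxA hmaxB f hfm ⟨1, hf1⟩
  rw [← hμtr] at key
  -- the right-hand side of `key` is `μ^tr(s)`
  have hchart_exp : ∀ y : Fin n → ℝ, chart (fun k => exp (Fin.snoc (α := fun _ => ℝ) y 0 k)) = y := by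
    intro y
    funext j
    simp [hchart, Real.log_exp]
  have hrhs : ∀ y : Fin n → ℝ, f (fun k => exp (Fin.snoc (α := fun _ => ℝ) y 0 k)) = s.indicator 1 y := by
    intro y
    simp only [hf]
    rw [hchart_exp]
  simp only [hrhs] at key
  rw [integral_indicator_one hs] at key
  -- the left-hand side of `key`, term by term, is `p_C · vol(ξ ∈ [0,1]^n : chart (x^C ξ) ∈ s)`
  have hlhs : ∀ C, ∫ ξ in unitCube n, f (X C ξ) =
      (((volume : Measure (Fin n → ℝ)).restrict (unitCube n)).map (fun ξ => chart (X C ξ))).real s := by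
    intro C
    have h1 : (fun ξ => f (X C ξ)) = ((fun ξ => chart (X C ξ)) ⁻¹' s).indicator 1 := by
      funext ξ
      simp only [hf]
      by_cases hξ : chart (X C ξ) ∈ s
      · rw [Set.indicator_of_mem hξ, Set.indicator_of_mem (show ξ ∈ (fun ξ => chart (X C ξ)) ⁻¹' s from hξ)]
        rfl
      · rw [Set.indicator_of_notMem hξ, Set.indicator_of_notMem (show ξ ∉ (fun ξ => chart (X C ξ)) ⁻¹' s from hξ)]
    rw [h1, integral_indicator_one (hs.preimage (hgm C)), measureReal_def, measureReal_def,
      Measure.map_apply (hgm C) hs]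
  have key2 : ∑ C, p C * (((volume : Measure (Fin n → ℝ)).restrict (unitCube n)).map (fun ξ => chart (X C ξ))).real s =
      μtr.real s := by
    rw [← key]
    exact Finset.sum_congr rfl fun C _ => congrArg _ (hlhs C).symm
  -- pass from real numbers to `ℝ≥0∞`
  rw [Measure.coe_finsetSum, Finset.sum_apply]
  simp only [Measure.smul_apply, smul_eq_mul]
  haveI : IsFiniteMeasure ((volume : Measure (Fin n → ℝ)).restrict (unitCube n)) := by
    refine isFiniteMeasure_restrict.mpr ?_
    rw [unitCube, Real.volume_pi_Ioo]
    simp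
  have hfin : ∀ C, (((volume : Measure (Fin n → ℝ)).restrict (unitCube n)).map (fun ξ => chart (X C ξ))) s ≠ ⊤ := by
    intro C
    rw [Measure.map_apply (hgm C) hs]
    exact measure_ne_top _ _
  calc ∑ C, ENNReal.ofReal (p C) * (((volume : Measure (Fin n → ℝ)).restrict (unitCube n)).map (fun ξ => chart (X C ξ))) s
      = ∑ C, ENNReal.ofReal (p C * (((volume : Measure (Fin n → ℝ)).restrict (unitCube n)).map (fun ξ => chart (X C ξ))).real s) := by
        refine Finset.sum_congr rfl fun C _ => ?_
        rw [ENNReal.ofReal_mul (hp0 C), measureReal_def, ENNReal.ofReal_toReal (hfin C)]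
    _ = ENNReal.ofReal (∑ C, p C * (((volume : Measure (Fin n → ℝ)).restrict (unitCube n)).map (fun ξ => chart (X C ξ))).real s) := by
        rw [ENNReal.ofReal_sum_of_nonneg]
        intro C _
        exact mul_nonneg (hp0 C) measureReal_nonneg
    _ = μtr s := by
        rw [key2, measureReal_def, ENNReal.ofReal_toReal (measure_ne_top μtr s)]

end Main

section Algorithm1

open MeasureTheory ProbabilityTheory Real Finset Matrix MvPolynomial

open scoped Pointwise

variable {n : ℕ} {ι κ : Type*} [Fintype ι] [Fintype κ]
  (a : ι → MvPolynomial (Fin (n + 1)) ℝ) (b : κ → MvPolynomial (Fin (n + 1)) ℝ) (ν : ι → ℝ) (ρ : κ → ℝ)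
  {𝓒 : Type*} [Fintype 𝓒] {Ω : Type*} {mΩ : MeasurableSpace Ω} {P : Measure Ω}

/-- The sample map `ξ ↦ x^{(𝒞)}(ξ)`, `x_m = Π_k ξ_k^{−u_m^{(𝒞,k)}/⟨u^{(𝒞,k)}, w^{(𝒞)}⟩}`, is measurable. Plumbing.
[cite: Borinsky2020, Algorithm 1 (tropical.tex l.839–856); Theorem 19 (l.797)] -/
theorem measurable_conePoint (U : Matrix (Fin n) (Fin n) ℝ) (w : Fin (n + 1) → ℝ) :
    Measurable fun (ξ : Fin n → ℝ) (m : Fin (n + 1)) => ∏ k, ξ k ^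
      (-(Fin.snoc (α := fun _ => ℝ) (fun i => U i k) 0 m) / (Fin.snoc (α := fun _ => ℝ) (fun i => U i k) 0 ⬝ᵥ w)) :=
  measurable_pi_lambda _ fun _ => Finset.measurable_prod _ fun k _ => (measurable_pi_apply k).pow_const _

/-- **Proposition 20 (Algorithm 1 — "Basic Monte Carlo quadrature of Euler–Mellin integrals"), first clause: `I = 𝔼[I^{(N)}]`.** Algorithm 1
("for all maximal cones 𝒞 ∈ 𝓜: for ℓ ∈ 1,…,N: Draw a random vector ξ ∈ [0,1]^{n−1} … Set x_k^{(ℓ)} = Π_i ξ_i^{−u_k^{(𝒞,i)}/⟨u^{(𝒞,i)},w^{(𝒞)}⟩}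
… Set I_𝒞^{(N)}[R_{a/b}] = (1/N) |det(u^{(𝒞,1)},…,𝟙)|/Π_k⟨u^{(𝒞,k)},w^{(𝒞)}⟩ Σ_ℓ R_{a/b}(x^{(ℓ)}). Return I^{(N)} = Σ_𝒞 I_𝒞^{(N)}[R_{a/b}]") is,
cone by cone, the i.i.d. mean `tropicalEstimate` of `TropicalSamplingEstimator.lean` with `I^tr` replaced by the cone prefactor and the
draws `ξ^{(𝒞,ℓ)}` uniform on the cube; for every bounded measurable `R` its expectation is the sector sum of Theorem 19, i.e. the chart
integral `∫ T·R` ("Algorithm 1 is an application of Theorem 5 on the integral I_𝒞[f] for each cone … with f(x) = R_{a/b}(x)"). Typed for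
ANY bounded measurable `R` in place of `R_{a/b}` (which is bounded by Corollary 9 under R3, `TropicalLowerBound.exists_abs_residual_le`).
[cite: Borinsky2020, Algorithm 1 (tropical.tex l.839–857); Proposition 20 and its proof (l.859–867) (= AIHPD 10 (2023) Prop. 4.6); Theorem 5 (l.349–355)] -/
theorem integral_algorithm1_eq_integral_tropical_mul (ha : ∀ i, a i ≠ 0) (hb : ∀ j, b j ≠ 0) (hν : ∀ i, 0 ≤ ν i)
    (hρ : ∀ j, 0 ≤ ρ j) {ε : ℝ} (hε : 0 < ε)
    (hgap : ∀ y : Fin (n + 1) → ℝ, ∀ k k',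
      ε * (y k - y k') ≤ (∑ j, ρ j * faceValue (b j) y) - ∑ i, ν i * faceValue (a i) y)
    (U : 𝓒 → Matrix (Fin n) (Fin n) ℝ) (hU : ∀ C, (U C).det ≠ 0)
    (hcover : volume (⋃ C, coneMap (U C) '' orthant n)ᶜ = 0)
    (hdisj : Pairwise fun C C' => AEDisjoint volume (coneMap (U C) '' orthant n) (coneMap (U C') '' orthant n))
    (wA wB : 𝓒 → Fin (n + 1) → ℝ)
    (hwA : ∀ C, wA C ∈ ∑ i, ν i • NP⟦a i⟧) (hwB : ∀ C, wB C ∈ ∑ j, ρ j • NP⟦b j⟧)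
    (hmaxA : ∀ C (l : Fin n → ℝ), (∀ k, 0 ≤ l k) → ∀ v ∈ ∑ i, ν i • NP⟦a i⟧,
      Fin.snoc (α := fun _ => ℝ) (U C *ᵥ l) 0 ⬝ᵥ v ≤ Fin.snoc (α := fun _ => ℝ) (U C *ᵥ l) 0 ⬝ᵥ wA C)
    (hmaxB : ∀ C (l : Fin n → ℝ), (∀ k, 0 ≤ l k) → ∀ v ∈ ∑ j, ρ j • NP⟦b j⟧,
      Fin.snoc (α := fun _ => ℝ) (U C *ᵥ l) 0 ⬝ᵥ v ≤ Fin.snoc (α := fun _ => ℝ) (U C *ᵥ l) 0 ⬝ᵥ wB C)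
    (R : (Fin (n + 1) → ℝ) → ℝ) (hRm : Measurable R) (hRb : ∃ B, ∀ x, |R x| ≤ B)
    (ξ : 𝓒 → ℕ → Ω → (Fin n → ℝ)) (hlaw : ∀ C ℓ, HasLaw (ξ C ℓ) ((volume : Measure (Fin n → ℝ)).restrict (unitCube n)) P)
    {N : ℕ} (hN : N ≠ 0) :
    ∫ ω, (∑ C, tropicalEstimate (|(U C).det| * ∏ k, 1 / (Fin.snoc (α := fun _ => ℝ) (fun i => U C i k) 0 ⬝ᵥ (wB C - wA C)))
        (fun ξ' : Fin n → ℝ => R (fun m => ∏ k, ξ' k ^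
          (-(Fin.snoc (α := fun _ => ℝ) (fun i => U C i k) 0 m) / (Fin.snoc (α := fun _ => ℝ) (fun i => U C i k) 0 ⬝ᵥ (wB C - wA C)))))
        (ξ C) N ω) ∂P =
      ∫ y : Fin n → ℝ, (∏ i, trop (a i) (fun k => exp (Fin.snoc (α := fun _ => ℝ) y 0 k)) ^ ν i) /
        (∏ j, trop (b j) (fun k => exp (Fin.snoc (α := fun _ => ℝ) y 0 k)) ^ ρ j) *
        R (fun k => exp (Fin.snoc (α := fun _ => ℝ) y 0 k)) := by
  haveI : IsProbabilityMeasure ((volume : Measure (Fin n → ℝ)).restrict (unitCube n)) := by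
    refine ⟨?_⟩
    rw [Measure.restrict_apply_univ, unitCube, Real.volume_pi_Ioo]
    simp
  obtain ⟨B, hB⟩ := hRb
  set X : 𝓒 → (Fin n → ℝ) → (Fin (n + 1) → ℝ) := fun C ξ' m => ∏ k, ξ' k ^
    (-(Fin.snoc (α := fun _ => ℝ) (fun i => U C i k) 0 m) / (Fin.snoc (α := fun _ => ℝ) (fun i => U C i k) 0 ⬝ᵥ (wB C - wA C)))
    with hX
  have hgm : ∀ C, Measurable (fun ξ' => R (X C ξ')) := fun C => hRm.comp (measurable_conePoint (U C) (wB C - wA C))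
  have hid : ∀ C k, IdentDistrib (ξ C k) (ξ C 0) P P := fun C k =>
    { aemeasurable_fst := (hlaw C k).aemeasurable
      aemeasurable_snd := (hlaw C 0).aemeasurable
      map_eq := by rw [(hlaw C k).map_eq, (hlaw C 0).map_eq] }
  have hgi : ∀ C, Integrable (fun ξ' => R (X C ξ')) ((volume : Measure (Fin n → ℝ)).restrict (unitCube n)) := fun C =>
    (memLp_two_of_abs_le (μ := (volume : Measure (Fin n → ℝ)).restrict (unitCube n)) (hgm C)
      (ae_of_all _ fun ξ' => hB _)).integrable one_le_two
  have hidR : ∀ C k, IdentDistrib (fun ω => R (X C (ξ C k ω))) (fun ξ' => R (X C ξ')) P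
      ((volume : Measure (Fin n → ℝ)).restrict (unitCube n)) := fun C k =>
    { aemeasurable_fst := (hgm C).comp_aemeasurable (hlaw C k).aemeasurable
      aemeasurable_snd := (hgm C).aemeasurable
      map_eq := by
        rw [← (hlaw C k).map_eq, AEMeasurable.map_map_of_aemeasurable (hgm C).aemeasurable (hlaw C k).aemeasurable]
        rfl }
  have hEi : ∀ C, Integrable (tropicalEstimate (|(U C).det| * ∏ k, 1 / (Fin.snoc (α := fun _ => ℝ) (fun i => U C i k) 0 ⬝ᵥ
      (wB C - wA C))) (fun ξ' => R (X C ξ')) (ξ C) N) P := by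
    intro C
    have h : tropicalEstimate (|(U C).det| * ∏ k, 1 / (Fin.snoc (α := fun _ => ℝ) (fun i => U C i k) 0 ⬝ᵥ (wB C - wA C)))
        (fun ξ' => R (X C ξ')) (ξ C) N = fun ω => (|(U C).det| * ∏ k, 1 / (Fin.snoc (α := fun _ => ℝ) (fun i => U C i k) 0 ⬝ᵥ
          (wB C - wA C))) / N * ∑ k ∈ range N, R (X C (ξ C k ω)) := by
      funext ω
      rw [tropicalEstimate_def]
    rw [h]
    exact (integrable_finsetSum _ fun k _ => ((hidR C k).integrable_iff).2 (hgi C)).const_mul _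
  rw [integral_finsetSum _ fun C _ => hEi C]
  rw [integral_tropical_mul_eq_sum_cones_of_gap a b ν ρ ha hb hν hρ hε hgap U hU hcover hdisj wA wB hwA hwB hmaxA hmaxB R hRm ⟨B, hB⟩]
  refine Finset.sum_congr rfl fun C _ => ?_
  rw [integral_tropicalEstimate (hgm C) (hlaw C 0) (hid C) (hgi C) hN]

/-- **Proposition 20, second clause: `var[I^{(N)}] = C/N`** — with the constant made explicit. If the draws `ξ^{(𝒞,ℓ)}` (all cones, all
`ℓ`) are independent and uniform on the cube, then `var[I^{(N)}] = (Σ_𝒞 pref_𝒞² · var_{ξ∼U[0,1]^{n−1}}[R(x^{(𝒞)}(ξ))]) / N` ("there is a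
constant C_𝒞 ≥ 0 for each cone integral such that var[I_𝒞^{(N)}] = C_𝒞/N and var[I^{(N)}] = Σ_𝒞 var[I_𝒞^{(N)}] = C/N"; the printed
sum over cones uses the independence of the cones' samples, here the hypothesis `iIndepFun` over `𝓜 × ℕ`).
[cite: Borinsky2020, Proposition 20 and its proof (tropical.tex l.859–867) (= AIHPD 10 (2023) Prop. 4.6); Algorithm 1 (l.839–857); Theorem 5 (l.349–355)] -/
theorem variance_algorithm1 (U : 𝓒 → Matrix (Fin n) (Fin n) ℝ) (wA wB : 𝓒 → Fin (n + 1) → ℝ)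
    (R : (Fin (n + 1) → ℝ) → ℝ) (hRm : Measurable R) (hRb : ∃ B, ∀ x, |R x| ≤ B)
    [IsProbabilityMeasure P] (ξ : 𝓒 → ℕ → Ω → (Fin n → ℝ))
    (hlaw : ∀ C ℓ, HasLaw (ξ C ℓ) ((volume : Measure (Fin n → ℝ)).restrict (unitCube n)) P)
    (hindep : iIndepFun (fun p : 𝓒 × ℕ => ξ p.1 p.2) P) {N : ℕ} (hN : N ≠ 0) :
    Var[fun ω => ∑ C, tropicalEstimate (|(U C).det| * ∏ k, 1 / (Fin.snoc (α := fun _ => ℝ) (fun i => U C i k) 0 ⬝ᵥ (wB C - wA C)))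
        (fun ξ' : Fin n → ℝ => R (fun m => ∏ k, ξ' k ^
          (-(Fin.snoc (α := fun _ => ℝ) (fun i => U C i k) 0 m) / (Fin.snoc (α := fun _ => ℝ) (fun i => U C i k) 0 ⬝ᵥ (wB C - wA C)))))
        (ξ C) N ω; P] =
      (∑ C, (|(U C).det| * ∏ k, 1 / (Fin.snoc (α := fun _ => ℝ) (fun i => U C i k) 0 ⬝ᵥ (wB C - wA C))) ^ 2 *
        Var[fun ξ' : Fin n → ℝ => R (fun m => ∏ k, ξ' k ^
          (-(Fin.snoc (α := fun _ => ℝ) (fun i => U C i k) 0 m) / (Fin.snoc (α := fun _ => ℝ) (fun i => U C i k) 0 ⬝ᵥ (wB C - wA C))));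
          (volume : Measure (Fin n → ℝ)).restrict (unitCube n)]) / N := by
  haveI : IsProbabilityMeasure ((volume : Measure (Fin n → ℝ)).restrict (unitCube n)) := by
    refine ⟨?_⟩
    rw [Measure.restrict_apply_univ, unitCube, Real.volume_pi_Ioo]
    simp
  obtain ⟨B, hB⟩ := hRb
  set X : 𝓒 → (Fin n → ℝ) → (Fin (n + 1) → ℝ) := fun C ξ' m => ∏ k, ξ' k ^
    (-(Fin.snoc (α := fun _ => ℝ) (fun i => U C i k) 0 m) / (Fin.snoc (α := fun _ => ℝ) (fun i => U C i k) 0 ⬝ᵥ (wB C - wA C)))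
    with hX
  set pref : 𝓒 → ℝ := fun C => |(U C).det| * ∏ k, 1 / (Fin.snoc (α := fun _ => ℝ) (fun i => U C i k) 0 ⬝ᵥ (wB C - wA C)) with hpref
  have hgm : ∀ C, Measurable (fun ξ' => R (X C ξ')) := fun C => hRm.comp (measurable_conePoint (U C) (wB C - wA C))
  -- the summands `Z_{(C,ℓ)} = (pref_C/N) · R(x^{(C)}(ξ^{(C,ℓ)}))`, pairwise independent
  set Z : 𝓒 × ℕ → Ω → ℝ := fun p ω => pref p.1 / N * R (X p.1 (ξ p.1 p.2 ω)) with hZ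
  have hsum : (fun ω => ∑ C, tropicalEstimate (pref C) (fun ξ' => R (X C ξ')) (ξ C) N ω) =
      ∑ p ∈ (univ : Finset 𝓒) ×ˢ range N, Z p := by
    funext ω
    rw [Finset.sum_apply, Finset.sum_product]
    refine Finset.sum_congr rfl fun C _ => ?_
    rw [tropicalEstimate_def, Finset.mul_sum]
  have hid : ∀ p : 𝓒 × ℕ, IdentDistrib (fun ω => R (X p.1 (ξ p.1 p.2 ω))) (fun ξ' => R (X p.1 ξ')) P
      ((volume : Measure (Fin n → ℝ)).restrict (unitCube n)) := fun p =>
    { aemeasurable_fst := (hgm p.1).comp_aemeasurable (hlaw p.1 p.2).aemeasurable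
      aemeasurable_snd := (hgm p.1).aemeasurable
      map_eq := by
        rw [← (hlaw p.1 p.2).map_eq, AEMeasurable.map_map_of_aemeasurable (hgm p.1).aemeasurable (hlaw p.1 p.2).aemeasurable]
        rfl }
  have hmem2 : ∀ C, MemLp (fun ξ' => R (X C ξ')) 2 ((volume : Measure (Fin n → ℝ)).restrict (unitCube n)) := fun C =>
    memLp_two_of_abs_le (μ := (volume : Measure (Fin n → ℝ)).restrict (unitCube n)) (hgm C) (ae_of_all _ fun ξ' => hB _)
  have hZmem : ∀ p : 𝓒 × ℕ, MemLp (Z p) 2 P := fun p =>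
    (((hid p).memLp_iff).2 (hmem2 p.1)).const_mul _
  have hZind : Set.Pairwise (↑((univ : Finset 𝓒) ×ˢ range N) : Set (𝓒 × ℕ)) fun p q => IndepFun (Z p) (Z q) P := by
    intro p _ q _ hpq
    have h := (hindep.indepFun hpq).comp (φ := fun v => pref p.1 / N * R (X p.1 v)) (ψ := fun v => pref q.1 / N * R (X q.1 v))
      (measurable_const.mul (hgm p.1)) (measurable_const.mul (hgm q.1))
    exact h
  rw [hsum, IndepFun.variance_sum (fun p _ => hZmem p) hZind, Finset.sum_product, Finset.sum_div]
  refine Finset.sum_congr rfl fun C _ => ?_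
  have hterm : ∀ ℓ ∈ range N, Var[Z (C, ℓ); P] =
      (pref C / N) ^ 2 * Var[fun ξ' => R (X C ξ'); (volume : Measure (Fin n → ℝ)).restrict (unitCube n)] := by
    intro ℓ _
    simp only [hZ]
    rw [variance_const_mul, (hid (C, ℓ)).variance_eq]
  rw [Finset.sum_congr rfl hterm, Finset.sum_const, Finset.card_range, nsmul_eq_mul]
  set V := Var[fun ξ' => R (X C ξ'); (volume : Measure (Fin n → ℝ)).restrict (unitCube n)] with hV
  have hN' : (N : ℝ) ≠ 0 := Nat.cast_ne_zero.2 hN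
  rw [div_pow]
  field_simp
  simp only [hpref]
  ring

/-- **Proposition 20 — "var[I^{(N)}] = C/N with some constant C ≥ 0"**, the constant bounded explicitly: for `|R| ≤ B` ("the integrand is
bounded and therefore also square integrable"), `var[I^{(N)}] ≤ (Σ_𝒞 pref_𝒞²) B² / N`.
[cite: Borinsky2020, Proposition 20 and its proof (tropical.tex l.859–867) (= AIHPD 10 (2023) Prop. 4.6)] -/
theorem variance_algorithm1_le (U : 𝓒 → Matrix (Fin n) (Fin n) ℝ) (wA wB : 𝓒 → Fin (n + 1) → ℝ)
    (R : (Fin (n + 1) → ℝ) → ℝ) (hRm : Measurable R) {B : ℝ} (hRb : ∀ x, |R x| ≤ B)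
    [IsProbabilityMeasure P] (ξ : 𝓒 → ℕ → Ω → (Fin n → ℝ))
    (hlaw : ∀ C ℓ, HasLaw (ξ C ℓ) ((volume : Measure (Fin n → ℝ)).restrict (unitCube n)) P)
    (hindep : iIndepFun (fun p : 𝓒 × ℕ => ξ p.1 p.2) P) {N : ℕ} (hN : N ≠ 0) :
    Var[fun ω => ∑ C, tropicalEstimate (|(U C).det| * ∏ k, 1 / (Fin.snoc (α := fun _ => ℝ) (fun i => U C i k) 0 ⬝ᵥ (wB C - wA C)))
        (fun ξ' : Fin n → ℝ => R (fun m => ∏ k, ξ' k ^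
          (-(Fin.snoc (α := fun _ => ℝ) (fun i => U C i k) 0 m) / (Fin.snoc (α := fun _ => ℝ) (fun i => U C i k) 0 ⬝ᵥ (wB C - wA C)))))
        (ξ C) N ω; P] ≤
      (∑ C, (|(U C).det| * ∏ k, 1 / (Fin.snoc (α := fun _ => ℝ) (fun i => U C i k) 0 ⬝ᵥ (wB C - wA C))) ^ 2) * B ^ 2 / N := by
  haveI : IsProbabilityMeasure ((volume : Measure (Fin n → ℝ)).restrict (unitCube n)) := by
    refine ⟨?_⟩
    rw [Measure.restrict_apply_univ, unitCube, Real.volume_pi_Ioo]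
    simp
  rw [variance_algorithm1 U wA wB R hRm ⟨B, hRb⟩ ξ hlaw hindep hN, Finset.sum_mul]
  have hN' : (0 : ℝ) < N := Nat.cast_pos.2 (Nat.pos_of_ne_zero hN)
  refine div_le_div_of_nonneg_right (Finset.sum_le_sum fun C _ => ?_) hN'.le
  refine mul_le_mul_of_nonneg_left ?_ (sq_nonneg _)
  exact variance_le_sq_of_abs_le (hRm.comp (measurable_conePoint (U C) (wB C - wA C))) (ae_of_all _ fun ξ' => hRb _)

end Algorithm1

end Literature.MathematicalPhysics.QuantumFieldTheory.Borinsky2020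

end
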